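import Mathlib
import Literature.NumberTheory.LFunctions.Zhang2022.TypedSection16BLemma162Rp
import Literature.NumberTheory.LFunctions.Zhang2022.Section16FrakU2MainProduct
import Literature.NumberTheory.LFunctions.Zhang2022.Section15CCalU1RNearOne
import Literature.NumberTheory.LFunctions.Zhang2022.AppendixAPrimeProducts
import Literature.NumberTheory.LFunctions.MertensElementary
import Literature.Analysis.Complex.HolomorphicProducts
import HarnessLib

/-!
# Zhang (2022), §16 Lemma 16.2 at the repaired normaliser (`Lemma162Rq`): the GLUE from the local
# Euler factors — continuation, the half-plane bound `C·e^{2𝓛^{1/10}}`, the near-`1` bound `C·𝓛`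
# and the value `E₂ⱼ(1) = frakU2Main + O(𝓛⁻⁴)` from per-prime data, kernel-checked

Topic `Literature/NumberTheory/LFunctions/Zhang2022` (Landau–Siegel audit tree; verdict-neutral).
Y. Zhang, *Discrete mean estimates and the Landau–Siegel zero*, arXiv:2211.02515v1 (2022)
[Zhang2022LandauSiegel], §16 Lemma 16.2 p. 94 (tex L4646–L4653) and its Appendix-A sketch pp. 105–106
(§A.u039–u042), **an unrefereed manuscript under adjudication; nothing here asserts or denies its
Theorems 1–2.** Lane ZHANG-L, WP16 Block D (row G-d57-1): the sub-leaf of record under `Eq16_16R2(E)`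
is `Typed.Section16B.Lemma162Rq c′` (file `TypedSection16BLemma162Rp`): the repaired
`E₂ⱼ = frakU2SeriesR` (normaliser `ζ(s)²ζ(s−βⱼ)L(s,χ)L(s−βⱼ,χ)²`) continues analytically to
`σ > 9/10`, is bounded there, obeys `‖U(s)‖ ≤ C·exp(2𝓛^{1/10})` on `Re s ≥ 19/20` and `‖U(s)‖ ≤ C·𝓛`
on `‖s − 1‖ ≤ 1/𝓛`, and `U(1) = frakU2Main + O(𝓛⁻⁴)`.

The Appendix-A sketch reaches this through an Euler product `E₂ⱼ(s) = ∏_q Φ_q(s)` with three kinds of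
local information: (H) for `q ∤ D`, `Φ_q` is holomorphic on `σ > 17/20` with
`‖Φ_q(s) − 1‖ ≤ C(q^{−2σ} + q^{−1−σ})`; (D) for `q ∣ D`, `Φ_q(s) = (1 − q^{−s})²` exactly (`χ(q) = 0`);
(V) for `q ∤ D`, `q ≤ D`, `‖Φ_q(1) − m_q‖ ≤ C·α·log q/q` with the main factors `m_q` of
`Typed.Section16B.hasProd_frakU2Main` (`∏_q m_q = frakU2Main`). This file PROVES THE GLUE, generic
in the family `Φ` (theorems only, no definitions, no facts), so that the prover of the local package
(zl-w09-p4: `Section16Lemma162RLocal`, `Section16Lemma162REuler`, …) closes `Lemma162Rq` by ONE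
application:

* `differentiableOn_tprod_of_local` — `∏'_q Φ_q` is holomorphic on `σ > 17/20` (Weierstrass
  `M`-test, `Literature.Analysis.Complex.differentiableOn_tprod_of_norm_sub_one_le`, majorant
  `2C q^{−17/10} + 3·[q ∣ D]`);
* `exists_halfPlane_bound_of_local` — `‖∏'_q Φ_q(s)‖ ≤ K·exp(2𝓛^{1/10})` on `Re s ≥ 9/10`
  (`∏_{q∣D}(1 + q^{−9/10})² ≤ K₀e^{2𝓛^{1/10}}`, `Typed.Section15C.prod_primeFactors_one_add_rpow_sq_le`);
* `exists_nearOne_bound_of_local` — `‖∏'_q Φ_q(s)‖ ≤ K·𝓛` on `‖s − 1‖ ≤ 1/𝓛` (`|q^{−s}| ≤ 3/q` for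
  `q ≤ D` there, `∏_{q∣D}(1 + 3/q)² ≤ (D/φ(D))⁶ ≤ (2 log 𝓛)⁶ ≤ 𝓛`;
  `Typed.Section15C.norm_one_sub_cpow_sq_le_near_one`, `Ded1524.self_div_totient_le_two_mul_loglog`);
* `norm_mainFactor_sub_one_le` — `‖m_q − 1‖ ≤ 10/q²` for `q ∤ D` (quadratic `χ`);
* `exists_value_bound_of_local` — `‖∏'_q Φ_q(1) − frakU2Main‖ ≤ K·α𝓛` (split off the exact factors
  at `q ∣ D`, `∏_{q∣D}(1−q⁻¹)² = (φ(D)/D)²`; compare the cofactors by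
  `AppendixA.norm_tprod_one_add_sub_tprod_one_add_le`; Mertens `MertensBound.sum_log_div_prime_le`
  for `q ≤ D`, `O(q⁻²)` tails with `D^{−1/2} ≤ α𝓛` for `q > D`);
* **`lemma162Rq_of_local`** — (H) + (D) + the `σ > 1` Euler identity
  `HasProd (q ↦ Φ_q(s)) (frakU2SeriesR c′ χ j s)` + (V) ⇒ `Lemma162Rq c′`, with `U := ∏'_q Φ_q`
  (so no identity theorem is needed for the value clause; `α𝓛 = π𝓛⁻⁸ ≤ π𝓛⁻⁴`).

These are the §16 twins of the §15 glue files `Section15CLemma153RpGlue` (p476187),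
`Section15CStep15u053RGlue` (p478591) and `Section15CCalU1RNearOne` (p479102). Any `σ₀ < 9/10` in
place of `17/20` would do. WHAT THIS IS NOT: a proof of (H), (D), the Euler identity or (V) for the
actual factors of `E₂ⱼ`, or of anything about Theorems 1–2 / Landau–Siegel zeros.

## References

* Y. Zhang, arXiv:2211.02515v1 (2022), §16 Lemma 16.2 p. 94; App. A pp. 105–106 (§A.u039–u042).
  [cite: Zhang2022LandauSiegel, §16 Lemma 16.2 p.94]
* J. B. Conway, *Functions of One Complex Variable I* (1978), VII.5. [cite: Conway1978, VII.5]
* G. H. Hardy, E. M. Wright, *An Introduction to the Theory of Numbers* (6th ed.), Thms 62, 328, 425.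
  [cite: HardyWright2008, Thm 425]
-/

noncomputable section

open Complex Real Filter Topology Finset

namespace Literature.NumberTheory.LFunctions.Zhang2022.Typed.Section16B

open Literature.NumberTheory.LFunctions.Zhang2022
open Literature.NumberTheory.LFunctions.Zhang2022.Skeleton

/-! ## Real-analysis and arithmetic helpers -/

/-- Products of reals over a sub-finset: factors `≥ 0` on `s` and `≥ 1` on `t ∖ s` give `∏_s f ≤ ∏_t f`.
[folklore] -/
private theorem prod_le_prod_of_subset_real {ι : Type*} [DecidableEq ι] {s t : Finset ι} (f : ι → ℝ)
    (hst : s ⊆ t) (hs : ∀ i ∈ s, 0 ≤ f i) (ht : ∀ i ∈ t, i ∉ s → 1 ≤ f i) :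
    ∏ i ∈ s, f i ≤ ∏ i ∈ t, f i := by
  rw [← Finset.prod_sdiff hst]
  have h1 : (1 : ℝ) ≤ ∏ i ∈ t \ s, f i := by
    rw [← Finset.prod_const_one (s := t \ s)]
    refine Finset.prod_le_prod (fun _ _ => zero_le_one) fun i hi => ?_
    exact ht i (Finset.mem_sdiff.mp hi).1 (Finset.mem_sdiff.mp hi).2
  have h0 : 0 ≤ ∏ i ∈ s, f i := Finset.prod_nonneg hs
  exact le_mul_of_one_le_left h0 h1

/-- `∏_{i∈A}(1 + x_i) ≤ exp(Σ_{i∈A} x_i)` for `x_i ≥ 0`. [folklore] -/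
private theorem prod_one_add_le_exp_sum {ι : Type*} (A : Finset ι) (x : ι → ℝ)
    (hx : ∀ i ∈ A, 0 ≤ x i) : ∏ i ∈ A, (1 + x i) ≤ Real.exp (∑ i ∈ A, x i) := by
  rw [Real.exp_sum]
  exact Finset.prod_le_prod (fun i hi => by linarith [hx i hi]) fun i _ => by
    linarith [Real.add_one_le_exp (x i)]

/-- `‖(1 − q^{−s})² − 1‖ ≤ 3` for `σ ≥ 0` (`|q^{−s}| ≤ 1`). [folklore] -/
private theorem norm_one_sub_cpow_sq_sub_one_le {q : ℕ} (hq : q.Prime) {s : ℂ} (hs : 0 ≤ s.re) :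
    ‖(1 - (q : ℂ) ^ (-s)) ^ 2 - 1‖ ≤ 3 := by
  have hq1 : (1 : ℝ) ≤ q := by exact_mod_cast hq.one_lt.le
  have hX : ‖(q : ℂ) ^ (-s)‖ ≤ 1 := by
    rw [Complex.norm_natCast_cpow_of_pos hq.pos, Complex.neg_re]
    exact Real.rpow_le_one_of_one_le_of_nonpos hq1 (by linarith)
  set X : ℂ := (q : ℂ) ^ (-s) with hXdef
  have e : (1 - X) ^ 2 - 1 = X * (X - 2) := by ring
  rw [e, norm_mul]
  have h2 : ‖X - 2‖ ≤ 3 := by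
    calc ‖X - 2‖ ≤ ‖X‖ + ‖(2 : ℂ)‖ := norm_sub_le _ _
      _ ≤ 1 + 2 := by
          have : ‖(2 : ℂ)‖ = 2 := by simp
          rw [this]; linarith
      _ = 3 := by norm_num
  calc ‖X‖ * ‖X - 2‖ ≤ 1 * 3 := mul_le_mul hX h2 (norm_nonneg _) (by norm_num)
    _ = 3 := by norm_num

/-- `‖1 − q^{−s}‖ ≤ 1 + q^{−9/10}` for `Re s ≥ 9/10`. [folklore] -/
private theorem norm_one_sub_cpow_le {q : ℕ} (hq : q.Prime) {s : ℂ} (hs : 9 / 10 ≤ s.re) :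
    ‖1 - (q : ℂ) ^ (-s)‖ ≤ 1 + (q : ℝ) ^ (-(9 / 10 : ℝ)) := by
  have hq1 : (1 : ℝ) ≤ q := by exact_mod_cast hq.one_lt.le
  calc ‖1 - (q : ℂ) ^ (-s)‖ ≤ ‖(1 : ℂ)‖ + ‖(q : ℂ) ^ (-s)‖ := norm_sub_le _ _
    _ ≤ 1 + (q : ℝ) ^ (-(9 / 10 : ℝ)) := by
        rw [norm_one, Complex.norm_natCast_cpow_of_pos hq.pos, Complex.neg_re]
        exact add_le_add le_rfl (Real.rpow_le_rpow_of_exponent_le hq1 (by linarith))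

/-- `Σ_q q^r` over the primes is summable for `r < −1`. [folklore] -/
private theorem summable_primes_rpow {r : ℝ} (hr : r < -1) :
    Summable fun q : Nat.Primes => ((q : ℕ) : ℝ) ^ r :=
  (Real.summable_nat_rpow.mpr hr).comp_injective Subtype.val_injective

/-- `Σ_q q^r ≤ Σ_n n^r` (primes vs. all naturals), `r < −1`. [folklore] -/
private theorem tsum_primes_rpow_le {r : ℝ} (hr : r < -1) :
    ∑' q : Nat.Primes, ((q : ℕ) : ℝ) ^ r ≤ ∑' n : ℕ, (n : ℝ) ^ r :=
  (summable_primes_rpow hr).tsum_le_tsum_of_inj (fun q : Nat.Primes => (q : ℕ))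
    Subtype.val_injective (fun n _ => Real.rpow_nonneg (Nat.cast_nonneg n) _) (fun _ => le_rfl)
    (Real.summable_nat_rpow.mpr hr)

/-- `log D ≥ L₀` once `D ≥ ⌈exp L₀⌉₊`. [folklore] -/
private theorem ell_ge_of_ge_ceil_exp {L₀ : ℝ} {D : ℕ} (hD : ⌈Real.exp L₀⌉₊ ≤ D) : L₀ ≤ ell D := by
  have hD' : Real.exp L₀ ≤ D := le_trans (Nat.le_ceil _) (by exact_mod_cast hD)
  have hD0 : (0 : ℝ) < D := lt_of_lt_of_le (Real.exp_pos _) hD'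
  rw [ell]; exact (Real.le_log_iff_exp_le hD0).mpr hD'

/-- `ℓ^k·e^{−cℓ} ≤ 1` once `ℓ ≥ (k+1)!/c^{k+1}` (`c > 0`, `ℓ > 0`). [folklore] -/
private theorem pow_mul_exp_neg_le_one {c ℓ : ℝ} (hc : 0 < c) (hℓ : 0 < ℓ) (k : ℕ)
    (hbig : (Nat.factorial (k + 1) : ℝ) / c ^ (k + 1) ≤ ℓ) : ℓ ^ k * Real.exp (-(c * ℓ)) ≤ 1 := by
  have h := Real.pow_div_factorial_le_exp (x := c * ℓ) (by positivity) (k + 1)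
  have hfac : (0 : ℝ) < Nat.factorial (k + 1) := by exact_mod_cast Nat.factorial_pos _
  have hck : 0 < c ^ (k + 1) := pow_pos hc _
  rw [Real.exp_neg, ← div_eq_mul_inv, div_le_one (Real.exp_pos _)]
  refine le_trans ?_ h
  rw [le_div_iff₀ hfac, mul_pow, pow_succ ℓ k]
  rw [div_le_iff₀ hck] at hbig
  have hℓk : 0 ≤ ℓ ^ k := pow_nonneg hℓ.le k
  nlinarith [mul_le_mul_of_nonneg_left hbig hℓk]

/-- **`D^{−1/2} ≤ α𝓛`** (`= π𝓛⁻⁸`) once `𝓛 ≥ 9!·2⁹`. [cite: Zhang2022LandauSiegel, §2 (2.10)] -/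
private theorem rpow_neg_half_le_alpha_ell {D : ℕ} (hD : 0 < D)
    (hℓ : (Nat.factorial 9 : ℝ) / (1 / 2 : ℝ) ^ 9 ≤ ell D) :
    (D : ℝ) ^ (-(1 / 2 : ℝ)) ≤ alpha D * ell D := by
  have hD0 : (0 : ℝ) < D := by exact_mod_cast hD
  have hℓ0 : 0 < ell D := lt_of_lt_of_le (by positivity) hℓ
  have hαℓ : alpha D * ell D = π / ell D ^ 8 := by
    rw [alpha, bigP, Real.log_exp]; field_simp
  have h := pow_mul_exp_neg_le_one (c := 1 / 2) (by norm_num) hℓ0 8 (by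
    have : (Nat.factorial (8 + 1) : ℝ) / (1 / 2 : ℝ) ^ (8 + 1) = (Nat.factorial 9 : ℝ) / (1 / 2) ^ 9 := by
      norm_num
    rw [this]; exact hℓ)
  have hDeq : (D : ℝ) ^ (-(1 / 2 : ℝ)) = Real.exp (-(1 / 2 * ell D)) := by
    rw [Real.rpow_def_of_pos hD0, show Real.log (D : ℝ) = ell D from rfl]
    congr 1; ring
  rw [hDeq, hαℓ, le_div_iff₀ (by positivity)]
  calc Real.exp (-(1 / 2 * ell D)) * ell D ^ 8 = ell D ^ 8 * Real.exp (-(1 / 2 * ell D)) := mul_comm _ _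
    _ ≤ 1 := h
    _ ≤ π := by linarith [Real.pi_gt_three]

/-- `α𝓛 = π/𝓛⁸ ≤ π·𝓛⁻⁴` once `𝓛 ≥ 1`. [cite: Zhang2022LandauSiegel, §2 (2.10)] -/
private theorem alpha_mul_ell_le {D : ℕ} (hℓ : 1 ≤ ell D) :
    alpha D * ell D ≤ π * (ell D ^ 4)⁻¹ := by
  have hℓ0 : 0 < ell D := by linarith
  have hαℓ : alpha D * ell D = π / ell D ^ 8 := by
    rw [alpha, bigP, Real.log_exp]; field_simp
  rw [hαℓ, div_eq_mul_inv]
  refine mul_le_mul_of_nonneg_left ?_ Real.pi_pos.le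
  refine inv_anti₀ (by positivity) ?_
  calc ell D ^ 4 = ell D ^ 4 * 1 := (mul_one _).symm
    _ ≤ ell D ^ 4 * ell D ^ 4 := by gcongr; exact one_le_pow₀ hℓ
    _ = ell D ^ 8 := by ring

/-- Mertens over the primes `≤ D`: `Σ_{q≤D} log q/q ≤ 2 log D` once `log D ≥ 2` (tree
`MertensBound.sum_log_div_prime_le`). [cite: HardyWright2008, Thm 425] -/
private theorem sum_log_div_primesLE_le {D : ℕ} (hℓ : 2 ≤ ell D) :
    ∑ q ∈ Nat.primesLE D, Real.log q / q ≤ 2 * ell D := by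
  have hlog4 : Real.log 4 ≤ 2 := by
    have : Real.log 4 = 2 * Real.log 2 := by
      rw [show (4 : ℝ) = 2 ^ 2 by norm_num, Real.log_pow]; norm_num
    rw [this]; nlinarith [Real.log_two_lt_d9]
  calc ∑ q ∈ Nat.primesLE D, Real.log q / q ≤ Real.log D + Real.log 4 :=
        MertensBound.sum_log_div_prime_le D
    _ ≤ 2 * ell D := by rw [show Real.log (D : ℝ) = ell D from rfl]; linarith

/-- **Euler's product for `φ`**: `(φ(D)/D)² = ∏_{q∣D}(1 − q⁻¹)²` (in `ℂ`, `D ≥ 1`).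
[cite: HardyWright2008, Thm 62] -/
private theorem totient_sq_div_sq_eq_prod {D : ℕ} (hD : 0 < D) :
    (Nat.totient D : ℂ) ^ 2 / (D : ℂ) ^ 2 = ∏ q ∈ D.primeFactors, (1 - ((q : ℂ))⁻¹) ^ 2 := by
  have hD0 : (D : ℂ) ≠ 0 := by exact_mod_cast hD.ne'
  have h := congrArg (fun x : ℚ => (x : ℂ)) (Nat.totient_eq_mul_prod_factors D)
  simp only [Rat.cast_natCast, Rat.cast_mul, Rat.cast_prod, Rat.cast_sub, Rat.cast_one,
    Rat.cast_inv] at h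
  rw [Finset.prod_pow, ← div_pow]
  congr 1
  rw [div_eq_iff hD0, h, mul_comm]

/-- `‖(φ(D)/D)²‖ ≤ 1`. [folklore] -/
private theorem norm_totient_sq_div_sq_le {D : ℕ} (hD : 0 < D) :
    ‖(Nat.totient D : ℂ) ^ 2 / (D : ℂ) ^ 2‖ ≤ 1 := by
  have hD0 : (0 : ℝ) < D := by exact_mod_cast hD
  have hφ : (Nat.totient D : ℝ) ≤ D := by exact_mod_cast Nat.totient_le D
  rw [norm_div, norm_pow, norm_pow, Complex.norm_natCast, Complex.norm_natCast,
    div_le_one (by positivity)]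
  exact pow_le_pow_left₀ (Nat.cast_nonneg _) hφ 2

/-- **`∏_{q∣n}(1 + c/q) ≤ (n/φ(n))^c`** for a natural number `c` (`n ≥ 1`): Bernoulli
`1 + c/q ≤ (1 + 1/q)^c` and `∏_{q∣n}(1 + 1/q) ≤ ∏_{q∣n}(1 − 1/q)⁻¹ = n/φ(n)`. [folklore] -/
private theorem prod_primeFactors_one_add_div_le_pow {n : ℕ} (hn : n ≠ 0) (c : ℕ) :
    ∏ q ∈ n.primeFactors, (1 + (c : ℝ) / q) ≤ ((n : ℝ) / Nat.totient n) ^ c := by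
  -- `∏_{q∣n}(1 + 1/q) ≤ n/φ(n)`
  have hP1 : 0 < ∏ q ∈ n.primeFactors, ((q : ℝ) - 1) :=
    Finset.prod_pos fun q hq => by
      have : (2 : ℝ) ≤ q := by exact_mod_cast (Nat.prime_of_mem_primeFactors hq).two_le
      linarith
  have hcast : (Nat.totient n : ℝ) * ∏ q ∈ n.primeFactors, (q : ℝ) =
      (n : ℝ) * ∏ q ∈ n.primeFactors, ((q : ℝ) - 1) := by
    have h := Nat.totient_mul_prod_primeFactors n
    have h' : ((Nat.totient n * ∏ p ∈ n.primeFactors, p : ℕ) : ℝ) =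
        ((n * ∏ p ∈ n.primeFactors, (p - 1) : ℕ) : ℝ) := by rw [h]
    push_cast at h'
    rw [h']
    congr 1
    refine Finset.prod_congr rfl fun q hq => ?_
    rw [Nat.cast_sub (Nat.prime_of_mem_primeFactors hq).one_lt.le, Nat.cast_one]
  have hone : ∏ q ∈ n.primeFactors, (1 + (q : ℝ)⁻¹) ≤ (n : ℝ) / Nat.totient n := by
    have hφpos : (0 : ℝ) < Nat.totient n := by
      exact_mod_cast Nat.totient_pos.mpr (Nat.pos_of_ne_zero hn)
    rw [le_div_iff₀ hφpos]
    have h2 : ∏ q ∈ n.primeFactors, (1 + (q : ℝ)⁻¹) ≤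
        ∏ q ∈ n.primeFactors, ((q : ℝ) / ((q : ℝ) - 1)) := by
      refine Finset.prod_le_prod (fun q _ => by positivity) fun q hq => ?_
      have hq2 : (2 : ℝ) ≤ q := by exact_mod_cast (Nat.prime_of_mem_primeFactors hq).two_le
      rw [le_div_iff₀ (by linarith)]
      have hq0 : (q : ℝ) ≠ 0 := by positivity
      field_simp
      nlinarith
    have h3 : (∏ q ∈ n.primeFactors, ((q : ℝ) / ((q : ℝ) - 1))) =
        (∏ q ∈ n.primeFactors, (q : ℝ)) / ∏ q ∈ n.primeFactors, ((q : ℝ) - 1) := by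
      rw [Finset.prod_div_distrib]
    calc (∏ q ∈ n.primeFactors, (1 + (q : ℝ)⁻¹)) * Nat.totient n
        ≤ (∏ q ∈ n.primeFactors, ((q : ℝ) / ((q : ℝ) - 1))) * Nat.totient n := by gcongr
      _ = ((Nat.totient n : ℝ) * ∏ q ∈ n.primeFactors, (q : ℝ)) /
            ∏ q ∈ n.primeFactors, ((q : ℝ) - 1) := by rw [h3]; ring
      _ = (n : ℝ) := by rw [hcast, mul_div_assoc, div_self hP1.ne', mul_one]
  have h1 : ∏ q ∈ n.primeFactors, (1 + (c : ℝ) / q) ≤ ∏ q ∈ n.primeFactors, (1 + (q : ℝ)⁻¹) ^ c := by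
    refine Finset.prod_le_prod (fun q _ => by positivity) fun q _ => ?_
    have hq : (-2 : ℝ) ≤ (q : ℝ)⁻¹ := by
      have : (0 : ℝ) ≤ (q : ℝ)⁻¹ := by positivity
      linarith
    have h := one_add_mul_le_pow hq c
    rw [div_eq_mul_inv]
    exact h
  rw [Finset.prod_pow] at h1
  exact h1.trans (pow_le_pow_left₀ (Finset.prod_nonneg fun q _ => by positivity) hone c)

/-- `(2 log 𝓛)⁶ ≤ 𝓛` and `𝓛 ≥ 10` for all large `D` (`𝓛 = log D`). [folklore] -/
private theorem eventually_loglog_pow_six_le :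
    ∃ N : ℕ, ∀ D : ℕ, N ≤ D → (2 * Real.log (ell D)) ^ 6 ≤ ell D ∧ 10 ≤ ell D := by
  have hℓ : Tendsto (fun D : ℕ => ell D) atTop atTop :=
    Real.tendsto_log_atTop.comp tendsto_natCast_atTop_atTop
  have h1 : Tendsto (fun x : ℝ => Real.log x ^ 6 / (1 * x + 0)) atTop (𝓝 0) :=
    Real.tendsto_pow_log_div_mul_add_atTop 1 0 6 one_ne_zero
  have h2 : ∀ᶠ D : ℕ in atTop, Real.log (ell D) ^ 6 / (1 * ell D + 0) ≤ 1 / 64 :=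
    (h1.comp hℓ).eventually (eventually_le_nhds (by norm_num))
  have h3 : ∀ᶠ D : ℕ in atTop, 10 ≤ ell D := hℓ.eventually (eventually_ge_atTop 10)
  obtain ⟨N, hN⟩ := Filter.eventually_atTop.mp (h2.and h3)
  refine ⟨N, fun D hD => ?_⟩
  obtain ⟨ha, hb⟩ := hN D hD
  have hℓ0 : 0 < ell D := by linarith
  rw [one_mul, add_zero, div_le_iff₀ hℓ0] at ha
  refine ⟨?_, hb⟩
  calc (2 * Real.log (ell D)) ^ 6 = 64 * Real.log (ell D) ^ 6 := by ring
    _ ≤ 64 * (1 / 64 * ell D) := by gcongr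
    _ = ell D := by ring

/-! ## The main factors `m_q` of `frakU2Main` -/

/-- **The main factor at a prime `q ∤ D` is within `10/q²` of `1`** (quadratic `χ`): `m_q = 3/8` if
`q = 2`, `χ(2) = 1`; else `m_q = (1 − q⁻²)/𝔭_q` with `‖𝔭_q − 1‖ ≤ 4/q²`
(`norm_frakpFactor_sub_one_le`) and `‖𝔭_q‖ ≥ 1/2`. [cite: Zhang2022LandauSiegel, §16 Lemma 16.2 p.94] -/
theorem norm_mainFactor_sub_one_le {D : ℕ} (χ : DirichletCharacter ℂ D) (hχ : χ.IsQuadratic)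
    {q : ℕ} (hq : q.Prime) [Decidable (q = 2 ∧ χ (2 : ZMod D) = 1)] :
    ‖(if q = 2 ∧ χ (2 : ZMod D) = 1 then (3 / 8 : ℂ)
        else (1 - (((q : ℂ)) ^ 2)⁻¹) / frakpFactor χ q) - 1‖ ≤ 10 / (q : ℝ) ^ 2 := by
  have hq2 : (2 : ℝ) ≤ q := by exact_mod_cast hq.two_le
  have hq0 : (0 : ℝ) < q := by linarith
  split_ifs with h2
  · -- `q = 2`, `χ(2) = 1`: `‖3/8 − 1‖ = 5/8 ≤ 10/4`
    obtain ⟨rfl, -⟩ := h2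
    have : (3 / 8 : ℂ) - 1 = ((-(5 / 8) : ℝ) : ℂ) := by push_cast; ring
    rw [this, Complex.norm_real, Real.norm_eq_abs]
    norm_num
  · -- generic: `p := frakpFactor χ q`, `‖p − 1‖ ≤ 4/q²`, `‖p‖ ≥ 1/2`
    set p : ℂ := frakpFactor χ q with hpdef
    have hp1 : ‖p - 1‖ ≤ 4 / (q : ℝ) ^ 2 := norm_frakpFactor_sub_one_le χ hq
    have hp_half : (1 / 2 : ℝ) ≤ ‖p‖ := by
      by_cases hq3 : 3 ≤ q
      · have hq3' : (3 : ℝ) ≤ q := by exact_mod_cast hq3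
        have h49 : 4 / (q : ℝ) ^ 2 ≤ 4 / 9 := by
          rw [div_le_div_iff₀ (by positivity) (by norm_num)]; nlinarith
        have h := norm_sub_norm_le (1 : ℂ) p
        rw [norm_one, norm_sub_rev] at h
        linarith
      · -- `q = 2` and `χ(2) ≠ 1`: `χ(2) ∈ {0, −1}`
        have hq2e : q = 2 := by
          have := hq.two_le; omega
        subst hq2e
        have hne1 : χ (2 : ZMod D) ≠ 1 := fun h1 => h2 ⟨rfl, h1⟩
        rcases hχ (2 : ZMod D) with h0 | h1 | hm1
        · -- `χ(2) = 0`: `p = 1`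
          have : p = 1 := by
            rw [hpdef, frakpFactor]
            push_cast
            rw [h0]; simp
          rw [this, norm_one]; norm_num
        · exact absurd h1 hne1
        · -- `χ(2) = −1`: `p = 4/3`
          have : p = ((4 / 3 : ℝ) : ℂ) := by
            rw [hpdef, frakpFactor]
            push_cast
            rw [hm1]; norm_num
          rw [this, Complex.norm_real, Real.norm_eq_abs]
          norm_num
    have hp0 : p ≠ 0 := fun h0 => by
      rw [h0, norm_zero] at hp_half; norm_num at hp_half
    set u : ℂ := (((q : ℂ)) ^ 2)⁻¹ with hudef
    have hun : ‖u‖ = 1 / (q : ℝ) ^ 2 := by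
      rw [hudef, norm_inv, norm_pow, Complex.norm_natCast, one_div]
    have e : (1 - u) / p - 1 = -(u + (p - 1)) / p := by
      field_simp
      ring
    rw [e, norm_div, norm_neg]
    rw [div_le_div_iff₀ (by positivity) (by positivity)]
    have hnum : ‖u + (p - 1)‖ ≤ 5 / (q : ℝ) ^ 2 := by
      calc ‖u + (p - 1)‖ ≤ ‖u‖ + ‖p - 1‖ := norm_add_le _ _
        _ ≤ 1 / (q : ℝ) ^ 2 + 4 / (q : ℝ) ^ 2 := add_le_add hun.le hp1
        _ = 5 / (q : ℝ) ^ 2 := by ring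
    have hq2pos : 0 < (q : ℝ) ^ 2 := by positivity
    calc ‖u + (p - 1)‖ * (q : ℝ) ^ 2 ≤ 5 / (q : ℝ) ^ 2 * (q : ℝ) ^ 2 :=
          mul_le_mul_of_nonneg_right hnum hq2pos.le
      _ = 5 := by field_simp
      _ = 10 * (1 / 2) := by norm_num
      _ ≤ 10 * ‖p‖ := by gcongr

/-! ## The Euler product is holomorphic on `σ > 17/20` -/

/-- **Holomorphy of `∏'_q Φ_q` on `σ > 17/20`** from the local data: each `Φ_q` holomorphic there;
`Φ_q = (1 − q^{−s})²` for `q ∣ D`; `‖Φ_q − 1‖ ≤ 2C′q^{−17/10}` for `q ∤ D` (Weierstrass `M`-test,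
`Literature.Analysis.Complex.differentiableOn_tprod_of_norm_sub_one_le`, majorant
`2C′q^{−17/10} + 3·[q ∣ D]`). [cite: Zhang2022LandauSiegel, App. A p. 105] -/
theorem differentiableOn_tprod_of_local {D : ℕ} (hD : 0 < D) {C' : ℝ} (hC' : 0 ≤ C')
    (F : Nat.Primes → ℂ → ℂ)
    (hdiff : ∀ q : Nat.Primes, DifferentiableOn ℂ (F q) {s : ℂ | 17 / 20 < s.re})
    (hdvd : ∀ q : Nat.Primes, (q : ℕ) ∣ D → ∀ s : ℂ, 17 / 20 < s.re →
      F q s = (1 - ((q : ℕ) : ℂ) ^ (-s)) ^ 2)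
    (hcop : ∀ q : Nat.Primes, ¬ (q : ℕ) ∣ D → ∀ s : ℂ, 17 / 20 < s.re →
      ‖F q s - 1‖ ≤ 2 * C' * ((q : ℕ) : ℝ) ^ (-(17 / 10 : ℝ))) :
    DifferentiableOn ℂ (fun s => ∏' q : Nat.Primes, F q s) {s : ℂ | 17 / 20 < s.re} := by
  classical
  set O : Set ℂ := {s : ℂ | 17 / 20 < s.re} with hOdef
  have hO : IsOpen O := isOpen_lt continuous_const Complex.continuous_re
  set b : Nat.Primes → ℝ := fun q =>
    2 * C' * ((q : ℕ) : ℝ) ^ (-(17 / 10 : ℝ)) + (if (q : ℕ) ∣ D then 3 else 0) with hbdef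
  have hb1sum : Summable fun q : Nat.Primes => 2 * C' * ((q : ℕ) : ℝ) ^ (-(17 / 10 : ℝ)) :=
    (summable_primes_rpow (by norm_num)).mul_left _
  set S₂ : Finset Nat.Primes := D.primeFactors.subtype Nat.Prime with hS₂def
  have hb2sum : Summable fun q : Nat.Primes => (if (q : ℕ) ∣ D then (3 : ℝ) else 0) := by
    refine summable_of_ne_finset_zero (s := S₂) fun q hq' => ?_
    have hndvd : ¬ (q : ℕ) ∣ D := fun h' =>
      hq' (Finset.mem_subtype.mpr (Nat.mem_primeFactors.mpr ⟨q.prop, h', hD.ne'⟩))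
    rw [if_neg hndvd]
  have hbsum : Summable b := hb1sum.add hb2sum
  have hFb : ∀ q : Nat.Primes, ∀ s ∈ O, ‖F q s - 1‖ ≤ b q := by
    intro q s hs
    have hs' : 17 / 20 < s.re := hs
    have hnn : 0 ≤ 2 * C' * ((q : ℕ) : ℝ) ^ (-(17 / 10 : ℝ)) := by positivity
    by_cases hqD : (q : ℕ) ∣ D
    · have h3 := norm_one_sub_cpow_sq_sub_one_le q.prop (s := s) (by linarith)
      rw [hdvd q hqD s hs']
      simp only [hbdef, if_pos hqD]
      linarith
    · simp only [hbdef, if_neg hqD, add_zero]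
      exact hcop q hqD s hs'
  exact Literature.Analysis.Complex.differentiableOn_tprod_of_norm_sub_one_le hO hdiff hbsum hFb

/-! ## The half-plane bound `‖∏'_q Φ_q(s)‖ ≤ K·e^{2𝓛^{1/10}}` on `Re s ≥ 9/10` -/

/-- **The explicit half-plane bound** (App. A p. 105; clause (iv) of `Lemma162Rq`, and (iii)): for a
constant `K ≥ 1` depending only on `C′`, every family with `Φ_q = (1 − q^{−s})²` (`q ∣ D`) and
`‖Φ_q(s) − 1‖ ≤ 2C′q^{−17/10}` (`q ∤ D`) on `σ > 17/20` satisfies `‖∏'_q Φ_q(s)‖ ≤ K·exp(2𝓛^{1/10})`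
for `Re s ≥ 9/10` (every finite partial product is `≤ ∏_{q∣D}(1 + q^{−9/10})²·exp(2C′ζ(17/10))`,
and `∏_{q∣D}(1 + q^{−9/10})² ≤ K₀e^{2𝓛^{1/10}}`, `Typed.Section15C.prod_primeFactors_one_add_rpow_sq_le`).
[cite: Zhang2022LandauSiegel, §16 Lemma 16.2 p.94] -/
theorem exists_halfPlane_bound_of_local {C' : ℝ} (hC' : 0 ≤ C') :
    ∃ K : ℝ, 1 ≤ K ∧ ∀ (D : ℕ), 0 < D → ∀ F : Nat.Primes → ℂ → ℂ,
      (∀ q : Nat.Primes, (q : ℕ) ∣ D → ∀ s : ℂ, 17 / 20 < s.re →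
        F q s = (1 - ((q : ℕ) : ℂ) ^ (-s)) ^ 2) →
      (∀ q : Nat.Primes, ¬ (q : ℕ) ∣ D → ∀ s : ℂ, 17 / 20 < s.re →
        ‖F q s - 1‖ ≤ 2 * C' * ((q : ℕ) : ℝ) ^ (-(17 / 10 : ℝ))) →
      ∀ s : ℂ, 9 / 10 ≤ s.re →
        ‖∏' q : Nat.Primes, F q s‖ ≤ K * Real.exp (2 * ell D ^ (1 / 10 : ℝ)) := by
  classical
  set Z : ℝ := ∑' n : ℕ, (n : ℝ) ^ (-(17 / 10 : ℝ)) with hZdef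
  have hZ0 : 0 ≤ Z := tsum_nonneg fun n => Real.rpow_nonneg (Nat.cast_nonneg n) _
  set CD : ℝ := Real.exp (20 * Real.exp ((10 ^ 10 + 1) / 10)) with hCDdef
  set K : ℝ := CD * Real.exp (2 * C' * Z) with hKdef
  have hCD1 : 1 ≤ CD := Real.one_le_exp (by positivity)
  have hE1 : 1 ≤ Real.exp (2 * C' * Z) := Real.one_le_exp (by positivity)
  have hK1 : 1 ≤ K := by
    calc (1 : ℝ) = 1 * 1 := by ring
      _ ≤ CD * Real.exp (2 * C' * Z) := mul_le_mul hCD1 hE1 zero_le_one (by positivity)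
  refine ⟨K, hK1, fun D hD F hdvd hcop s hs => ?_⟩
  have hb1sum : Summable fun q : Nat.Primes => 2 * C' * ((q : ℕ) : ℝ) ^ (-(17 / 10 : ℝ)) :=
    (summable_primes_rpow (by norm_num)).mul_left _
  have hsO : 17 / 20 < s.re := by linarith
  have hCDle : ∏ q ∈ D.primeFactors, (1 + (q : ℝ) ^ (-(9 / 10 : ℝ))) ^ 2 ≤
      CD * Real.exp (2 * Real.log D ^ (1 / 10 : ℝ)) :=
    Typed.Section15C.prod_primeFactors_one_add_rpow_sq_le D
  have hB1 : 1 ≤ K * Real.exp (2 * ell D ^ (1 / 10 : ℝ)) := by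
    have hℓ : 0 ≤ ell D := by rw [ell]; exact Real.log_natCast_nonneg D
    have h3 : 1 ≤ Real.exp (2 * ell D ^ (1 / 10 : ℝ)) :=
      Real.one_le_exp (by have := Real.rpow_nonneg hℓ (1 / 10 : ℝ); positivity)
    calc (1 : ℝ) = 1 * 1 := by ring
      _ ≤ K * Real.exp (2 * ell D ^ (1 / 10 : ℝ)) := mul_le_mul hK1 h3 zero_le_one (by positivity)
  refine Literature.Analysis.Complex.norm_tprod_le_of_forall_norm_prod_le (fun q => F q s) hB1
    fun A => ?_
  rw [Complex.norm_prod, ← Finset.prod_filter_mul_prod_filter_not A (fun q : Nat.Primes => (q : ℕ) ∣ D)]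
  -- the `q ∣ D` part
  have hdvd_part : ∏ q ∈ A.filter (fun q : Nat.Primes => (q : ℕ) ∣ D), ‖F q s‖ ≤
      CD * Real.exp (2 * ell D ^ (1 / 10 : ℝ)) := by
    have h1 : ∏ q ∈ A.filter (fun q : Nat.Primes => (q : ℕ) ∣ D), ‖F q s‖ ≤
        ∏ q ∈ A.filter (fun q : Nat.Primes => (q : ℕ) ∣ D),
          (1 + ((q : ℕ) : ℝ) ^ (-(9 / 10 : ℝ))) ^ 2 := by
      refine Finset.prod_le_prod (fun _ _ => norm_nonneg _) fun q hq => ?_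
      have hqD : (q : ℕ) ∣ D := (Finset.mem_filter.mp hq).2
      rw [hdvd q hqD s hsO, norm_pow]
      exact pow_le_pow_left₀ (norm_nonneg _) (norm_one_sub_cpow_le q.prop hs) 2
    set g : ℕ → ℝ := fun n => (1 + (n : ℝ) ^ (-(9 / 10 : ℝ))) ^ 2 with hgdef
    have h2 : ∏ q ∈ A.filter (fun q : Nat.Primes => (q : ℕ) ∣ D),
        (1 + ((q : ℕ) : ℝ) ^ (-(9 / 10 : ℝ))) ^ 2 =
        ∏ n ∈ (A.filter (fun q : Nat.Primes => (q : ℕ) ∣ D)).map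
          (Function.Embedding.subtype _), g n := by
      rw [Finset.prod_map]
      rfl
    have hsubset : (A.filter (fun q : Nat.Primes => (q : ℕ) ∣ D)).map
        (Function.Embedding.subtype _) ⊆ D.primeFactors := by
      intro n hn
      obtain ⟨q, hq, rfl⟩ := Finset.mem_map.mp hn
      have hqD : (q : ℕ) ∣ D := (Finset.mem_filter.mp hq).2
      exact Nat.mem_primeFactors.mpr ⟨q.prop, hqD, hD.ne'⟩
    have h3 : ∏ n ∈ (A.filter (fun q : Nat.Primes => (q : ℕ) ∣ D)).map
          (Function.Embedding.subtype _), g n ≤ ∏ n ∈ D.primeFactors, g n :=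
      prod_le_prod_of_subset_real g hsubset (fun n _ => by positivity) (fun n _ _ => by
        simp only [hgdef]
        have : 0 ≤ (n : ℝ) ^ (-(9 / 10 : ℝ)) := Real.rpow_nonneg (Nat.cast_nonneg n) _
        nlinarith)
    calc ∏ q ∈ A.filter (fun q : Nat.Primes => (q : ℕ) ∣ D), ‖F q s‖
        ≤ ∏ n ∈ D.primeFactors, g n := h1.trans (h2 ▸ h3)
      _ ≤ CD * Real.exp (2 * Real.log D ^ (1 / 10 : ℝ)) := hCDle
      _ = CD * Real.exp (2 * ell D ^ (1 / 10 : ℝ)) := by rw [ell]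
  -- the `q ∤ D` part
  have hcop_part : ∏ q ∈ A.filter (fun q : Nat.Primes => ¬ (q : ℕ) ∣ D), ‖F q s‖ ≤
      Real.exp (2 * C' * Z) := by
    have h1 : ∏ q ∈ A.filter (fun q : Nat.Primes => ¬ (q : ℕ) ∣ D), ‖F q s‖ ≤
        ∏ q ∈ A.filter (fun q : Nat.Primes => ¬ (q : ℕ) ∣ D),
          (1 + 2 * C' * ((q : ℕ) : ℝ) ^ (-(17 / 10 : ℝ))) := by
      refine Finset.prod_le_prod (fun _ _ => norm_nonneg _) fun q hq => ?_
      have hqD : ¬ (q : ℕ) ∣ D := (Finset.mem_filter.mp hq).2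
      have hb := hcop q hqD s hsO
      calc ‖F q s‖ ≤ ‖F q s - 1‖ + ‖(1 : ℂ)‖ := by
            have := norm_add_le (F q s - 1) 1; rwa [sub_add_cancel] at this
        _ ≤ 2 * C' * ((q : ℕ) : ℝ) ^ (-(17 / 10 : ℝ)) + 1 := by rw [norm_one]; linarith
        _ = 1 + 2 * C' * ((q : ℕ) : ℝ) ^ (-(17 / 10 : ℝ)) := by ring
    have h2 := prod_one_add_le_exp_sum (A.filter (fun q : Nat.Primes => ¬ (q : ℕ) ∣ D))
      (fun q : Nat.Primes => 2 * C' * ((q : ℕ) : ℝ) ^ (-(17 / 10 : ℝ))) (fun q _ => by positivity)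
    have h3 : ∑ q ∈ A.filter (fun q : Nat.Primes => ¬ (q : ℕ) ∣ D),
        2 * C' * ((q : ℕ) : ℝ) ^ (-(17 / 10 : ℝ)) ≤ 2 * C' * Z := by
      have h4 : ∑ q ∈ A.filter (fun q : Nat.Primes => ¬ (q : ℕ) ∣ D),
          2 * C' * ((q : ℕ) : ℝ) ^ (-(17 / 10 : ℝ)) ≤
          ∑' q : Nat.Primes, 2 * C' * ((q : ℕ) : ℝ) ^ (-(17 / 10 : ℝ)) :=
        hb1sum.sum_le_tsum _ (fun q _ => by positivity)
      have h5 : ∑' q : Nat.Primes, 2 * C' * ((q : ℕ) : ℝ) ^ (-(17 / 10 : ℝ)) ≤ 2 * C' * Z := by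
        rw [tsum_mul_left]
        exact mul_le_mul_of_nonneg_left (tsum_primes_rpow_le (by norm_num)) (by positivity)
      exact h4.trans h5
    exact h1.trans (h2.trans (Real.exp_le_exp.mpr h3))
  have hnn1 : 0 ≤ ∏ q ∈ A.filter (fun q : Nat.Primes => ¬ (q : ℕ) ∣ D), ‖F q s‖ :=
    Finset.prod_nonneg fun _ _ => norm_nonneg _
  calc (∏ q ∈ A.filter (fun q : Nat.Primes => (q : ℕ) ∣ D), ‖F q s‖) *
        ∏ q ∈ A.filter (fun q : Nat.Primes => ¬ (q : ℕ) ∣ D), ‖F q s‖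
      ≤ (CD * Real.exp (2 * ell D ^ (1 / 10 : ℝ))) * Real.exp (2 * C' * Z) :=
        mul_le_mul hdvd_part hcop_part hnn1 (by positivity)
    _ = K * Real.exp (2 * ell D ^ (1 / 10 : ℝ)) := by rw [hKdef]; ring

/-! ## The near-`1` bound `‖∏'_q Φ_q(s)‖ ≤ K·𝓛` on `‖s − 1‖ ≤ 1/𝓛` -/

/-- **The near-`1` bound** (clause (v) of `Lemma162Rq`; §16 twin of
`Typed.Section15C.calU1R_near_one_of_local`): for a constant `K ≥ 1` depending only on `C′`, for
`D ≥ 3` with `D/φ(D) ≤ 2 log 𝓛`, `(2 log 𝓛)⁶ ≤ 𝓛`, `𝓛 ≥ 10`, every family as in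
`exists_halfPlane_bound_of_local` has `‖∏'_q Φ_q(s)‖ ≤ K·𝓛` whenever `‖s − 1‖ ≤ 1/𝓛`
(`‖(1 − q^{−s})²‖ ≤ (1 + 3/q)²` for `q ≤ D` on that disc,
`Typed.Section15C.norm_one_sub_cpow_sq_le_near_one`; `∏_{q∣D}(1 + 3/q)² ≤ (D/φ(D))⁶ ≤ 𝓛`).
[cite: Zhang2022LandauSiegel, §16 Lemma 16.2 p.94] -/
theorem exists_nearOne_bound_of_local {C' : ℝ} (hC' : 0 ≤ C') :
    ∃ K : ℝ, 1 ≤ K ∧ ∀ (D : ℕ), 3 ≤ D → (D : ℝ) / Nat.totient D ≤ 2 * Real.log (ell D) →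
      (2 * Real.log (ell D)) ^ 6 ≤ ell D → 10 ≤ ell D → ∀ F : Nat.Primes → ℂ → ℂ,
      (∀ q : Nat.Primes, (q : ℕ) ∣ D → ∀ s : ℂ, 17 / 20 < s.re →
        F q s = (1 - ((q : ℕ) : ℂ) ^ (-s)) ^ 2) →
      (∀ q : Nat.Primes, ¬ (q : ℕ) ∣ D → ∀ s : ℂ, 17 / 20 < s.re →
        ‖F q s - 1‖ ≤ 2 * C' * ((q : ℕ) : ℝ) ^ (-(17 / 10 : ℝ))) →
      ∀ s : ℂ, ‖s - 1‖ ≤ 1 / ell D → ‖∏' q : Nat.Primes, F q s‖ ≤ K * ell D := by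
  classical
  set Z : ℝ := ∑' n : ℕ, (n : ℝ) ^ (-(17 / 10 : ℝ)) with hZdef
  have hZ0 : 0 ≤ Z := tsum_nonneg fun n => Real.rpow_nonneg (Nat.cast_nonneg n) _
  set K : ℝ := Real.exp (2 * C' * Z) with hKdef
  have hK1 : 1 ≤ K := Real.one_le_exp (by positivity)
  refine ⟨K, hK1, fun D hD3 hφ hpow6 hℓ10 F hdvd hcop s hs => ?_⟩
  have hDpos : 0 < D := by omega
  have hℓ0 : 0 < ell D := by linarith
  have hb1sum : Summable fun q : Nat.Primes => 2 * C' * ((q : ℕ) : ℝ) ^ (-(17 / 10 : ℝ)) :=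
    (summable_primes_rpow (by norm_num)).mul_left _
  have hσ : 1 - 1 / ell D ≤ s.re := by
    have h1 : |(s - 1).re| ≤ ‖s - 1‖ := Complex.abs_re_le_norm _
    rw [Complex.sub_re, Complex.one_re] at h1
    have := (abs_le.mp (h1.trans hs)).1
    linarith
  have hinv : 1 / ell D ≤ 1 / 10 := one_div_le_one_div_of_le (by norm_num) hℓ10
  have hsO : 17 / 20 < s.re := by linarith
  have hφ1 : (1 : ℝ) ≤ (D : ℝ) / Nat.totient D := by
    rw [le_div_iff₀ (by exact_mod_cast Nat.totient_pos.mpr hDpos)]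
    simpa using (show (Nat.totient D : ℝ) ≤ D by exact_mod_cast Nat.totient_le D)
  have hB1 : 1 ≤ K * ((D : ℝ) / Nat.totient D) ^ 6 := by
    calc (1 : ℝ) = 1 * 1 := (mul_one _).symm
      _ ≤ K * ((D : ℝ) / Nat.totient D) ^ 6 :=
          mul_le_mul hK1 (one_le_pow₀ hφ1) zero_le_one (by positivity)
  have hUB : ‖∏' q : Nat.Primes, F q s‖ ≤ K * ((D : ℝ) / Nat.totient D) ^ 6 := by
    refine Literature.Analysis.Complex.norm_tprod_le_of_forall_norm_prod_le (fun q => F q s) hB1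
      fun A => ?_
    rw [Complex.norm_prod,
      ← Finset.prod_filter_mul_prod_filter_not A (fun q : Nat.Primes => (q : ℕ) ∣ D)]
    -- the `q ∣ D` part: `≤ ∏_{q∣D}(1 + 3/q)² ≤ (D/φ(D))⁶`
    have hdvd_part : ∏ q ∈ A.filter (fun q : Nat.Primes => (q : ℕ) ∣ D), ‖F q s‖ ≤
        ((D : ℝ) / Nat.totient D) ^ 6 := by
      have h1 : ∏ q ∈ A.filter (fun q : Nat.Primes => (q : ℕ) ∣ D), ‖F q s‖ ≤
          ∏ q ∈ A.filter (fun q : Nat.Primes => (q : ℕ) ∣ D), (1 + 3 / ((q : ℕ) : ℝ)) ^ 2 := by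
        refine Finset.prod_le_prod (fun _ _ => norm_nonneg _) fun q hq => ?_
        have hqD : (q : ℕ) ∣ D := (Finset.mem_filter.mp hq).2
        rw [hdvd q hqD s hsO]
        exact Typed.Section15C.norm_one_sub_cpow_sq_le_near_one hD3 q.prop (Nat.le_of_dvd hDpos hqD)
          (by rw [ell] at hs; exact hs)
      set g : ℕ → ℝ := fun n => (1 + 3 / (n : ℝ)) ^ 2 with hgdef
      have h2 : ∏ q ∈ A.filter (fun q : Nat.Primes => (q : ℕ) ∣ D), (1 + 3 / ((q : ℕ) : ℝ)) ^ 2 =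
          ∏ n ∈ (A.filter (fun q : Nat.Primes => (q : ℕ) ∣ D)).map
            (Function.Embedding.subtype _), g n := by
        rw [Finset.prod_map]
        rfl
      have hsubset : (A.filter (fun q : Nat.Primes => (q : ℕ) ∣ D)).map
          (Function.Embedding.subtype _) ⊆ D.primeFactors := by
        intro n hn
        obtain ⟨q, hq, rfl⟩ := Finset.mem_map.mp hn
        have hqD : (q : ℕ) ∣ D := (Finset.mem_filter.mp hq).2
        exact Nat.mem_primeFactors.mpr ⟨q.prop, hqD, hDpos.ne'⟩
      have h3 : ∏ n ∈ (A.filter (fun q : Nat.Primes => (q : ℕ) ∣ D)).map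
            (Function.Embedding.subtype _), g n ≤ ∏ n ∈ D.primeFactors, g n :=
        prod_le_prod_of_subset_real g hsubset (fun n _ => by positivity) (fun n _ _ => by
          simp only [hgdef]
          have : 0 ≤ 3 / (n : ℝ) := by positivity
          nlinarith)
      have h4 : ∏ n ∈ D.primeFactors, g n ≤ ((D : ℝ) / Nat.totient D) ^ 6 := by
        have h5 := prod_primeFactors_one_add_div_le_pow hDpos.ne' 3
        have h6 : ∏ n ∈ D.primeFactors, g n =
            (∏ n ∈ D.primeFactors, (1 + ((3 : ℕ) : ℝ) / n)) ^ 2 := by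
          rw [← Finset.prod_pow]
          refine Finset.prod_congr rfl fun n _ => ?_
          simp only [hgdef]; push_cast; ring
        rw [h6]
        calc (∏ n ∈ D.primeFactors, (1 + ((3 : ℕ) : ℝ) / n)) ^ 2
            ≤ (((D : ℝ) / Nat.totient D) ^ 3) ^ 2 :=
              pow_le_pow_left₀ (Finset.prod_nonneg fun n _ => by positivity) h5 2
          _ = ((D : ℝ) / Nat.totient D) ^ 6 := by ring
      calc ∏ q ∈ A.filter (fun q : Nat.Primes => (q : ℕ) ∣ D), ‖F q s‖
          ≤ ∏ n ∈ D.primeFactors, g n := h1.trans (h2 ▸ h3)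
        _ ≤ ((D : ℝ) / Nat.totient D) ^ 6 := h4
    -- the `q ∤ D` part: `≤ exp(2C'Z) = K`
    have hcop_part : ∏ q ∈ A.filter (fun q : Nat.Primes => ¬ (q : ℕ) ∣ D), ‖F q s‖ ≤ K := by
      have h1 : ∏ q ∈ A.filter (fun q : Nat.Primes => ¬ (q : ℕ) ∣ D), ‖F q s‖ ≤
          ∏ q ∈ A.filter (fun q : Nat.Primes => ¬ (q : ℕ) ∣ D),
            (1 + 2 * C' * ((q : ℕ) : ℝ) ^ (-(17 / 10 : ℝ))) := by
        refine Finset.prod_le_prod (fun _ _ => norm_nonneg _) fun q hq => ?_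
        have hqD : ¬ (q : ℕ) ∣ D := (Finset.mem_filter.mp hq).2
        have hb := hcop q hqD s hsO
        calc ‖F q s‖ ≤ ‖F q s - 1‖ + ‖(1 : ℂ)‖ := by
              have := norm_add_le (F q s - 1) 1; rwa [sub_add_cancel] at this
          _ ≤ 2 * C' * ((q : ℕ) : ℝ) ^ (-(17 / 10 : ℝ)) + 1 := by rw [norm_one]; linarith
          _ = 1 + 2 * C' * ((q : ℕ) : ℝ) ^ (-(17 / 10 : ℝ)) := by ring
      have h2 := prod_one_add_le_exp_sum (A.filter (fun q : Nat.Primes => ¬ (q : ℕ) ∣ D))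
        (fun q : Nat.Primes => 2 * C' * ((q : ℕ) : ℝ) ^ (-(17 / 10 : ℝ))) (fun q _ => by positivity)
      have h3 : ∑ q ∈ A.filter (fun q : Nat.Primes => ¬ (q : ℕ) ∣ D),
          2 * C' * ((q : ℕ) : ℝ) ^ (-(17 / 10 : ℝ)) ≤ 2 * C' * Z := by
        have h4 : ∑ q ∈ A.filter (fun q : Nat.Primes => ¬ (q : ℕ) ∣ D),
            2 * C' * ((q : ℕ) : ℝ) ^ (-(17 / 10 : ℝ)) ≤
            ∑' q : Nat.Primes, 2 * C' * ((q : ℕ) : ℝ) ^ (-(17 / 10 : ℝ)) :=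
          hb1sum.sum_le_tsum _ (fun q _ => by positivity)
        have h5 : ∑' q : Nat.Primes, 2 * C' * ((q : ℕ) : ℝ) ^ (-(17 / 10 : ℝ)) ≤ 2 * C' * Z := by
          rw [tsum_mul_left]
          exact mul_le_mul_of_nonneg_left (tsum_primes_rpow_le (by norm_num)) (by positivity)
        exact h4.trans h5
      exact h1.trans (h2.trans ((Real.exp_le_exp.mpr h3).trans (le_of_eq hKdef.symm)))
    have hnn1 : 0 ≤ ∏ q ∈ A.filter (fun q : Nat.Primes => ¬ (q : ℕ) ∣ D), ‖F q s‖ :=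
      Finset.prod_nonneg fun _ _ => norm_nonneg _
    calc (∏ q ∈ A.filter (fun q : Nat.Primes => (q : ℕ) ∣ D), ‖F q s‖) *
          ∏ q ∈ A.filter (fun q : Nat.Primes => ¬ (q : ℕ) ∣ D), ‖F q s‖
        ≤ ((D : ℝ) / Nat.totient D) ^ 6 * K :=
          mul_le_mul hdvd_part hcop_part hnn1 (by positivity)
      _ = K * ((D : ℝ) / Nat.totient D) ^ 6 := by ring
  -- `(D/φ(D))⁶ ≤ (2 log 𝓛)⁶ ≤ 𝓛`
  have h6 : ((D : ℝ) / Nat.totient D) ^ 6 ≤ ell D :=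
    (pow_le_pow_left₀ (le_trans zero_le_one hφ1) hφ 6).trans hpow6
  exact hUB.trans (mul_le_mul_of_nonneg_left h6 (le_trans zero_le_one hK1))

/-! ## The value at `1`: `‖∏'_q Φ_q(1) − frakU2Main‖ ≤ K·α𝓛` -/

open scoped Classical in
/-- **The value glue** (App. A p. 105–106 value arithmetic; clause (vi) of `Lemma162Rq`): for a
constant `K` depending only on `C_b, C_v`, for every quadratic `χ` mod `D` with `𝓛 ≥ 2` and
`𝓛 ≥ 9!·2⁹`, every family of values `Φ_q(1)` with `Φ_q(1) = (1 − q⁻¹)²` (`q ∣ D`),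
`‖Φ_q(1) − 1‖ ≤ 2C_b q⁻²` (`q ∤ D`) and `‖Φ_q(1) − m_q‖ ≤ C_v·α·log q/q` (`q ∤ D`, `q ≤ D`; `m_q` the
factors of `hasProd_frakU2Main`) satisfies `‖∏'_q Φ_q(1) − frakU2Main χ‖ ≤ K·α𝓛`: split off the
exact factors at `q ∣ D` (`∏_{q∣D}(1−q⁻¹)² = (φ(D)/D)²`, norm `≤ 1`) from both products and compare the
cofactors by `‖∏'(1+f) − ∏'(1+g)‖ ≤ e^{Σ‖f‖+Σ‖g‖}Σ‖f−g‖`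
(`AppendixA.norm_tprod_one_add_sub_tprod_one_add_le`) with
`Σ‖f−g‖ ≤ 2C_vα𝓛 + (2C_b+10)ζ(3/2)D^{−1/2}` (Mertens for `q ≤ D`; `O(q⁻²)` for `q > D`) and
`D^{−1/2} ≤ α𝓛`. [cite: Zhang2022LandauSiegel, §16 Lemma 16.2 p.94] -/
theorem exists_value_bound_of_local {Cb Cv : ℝ} (hCb : 0 ≤ Cb) (hCv : 0 ≤ Cv) :
    ∃ K : ℝ, 0 ≤ K ∧ ∀ (D : ℕ) [NeZero D] (χ : DirichletCharacter ℂ D), χ.IsQuadratic →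
      2 ≤ ell D → (Nat.factorial 9 : ℝ) / (1 / 2 : ℝ) ^ 9 ≤ ell D → ∀ F1 : Nat.Primes → ℂ,
      (∀ q : Nat.Primes, (q : ℕ) ∣ D → F1 q = (1 - (((q : ℕ) : ℂ))⁻¹) ^ 2) →
      (∀ q : Nat.Primes, ¬ (q : ℕ) ∣ D → ‖F1 q - 1‖ ≤ 2 * Cb * ((q : ℕ) : ℝ) ^ (-(2 : ℝ))) →
      (∀ q : Nat.Primes, ¬ (q : ℕ) ∣ D → ((q : ℕ) : ℝ) ≤ D →
        ‖F1 q - (if (q : ℕ) = 2 ∧ χ (2 : ZMod D) = 1 then (3 / 8 : ℂ)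
            else (1 - ((((q : ℕ) : ℂ)) ^ 2)⁻¹) / frakpFactor χ q)‖ ≤
          Cv * (alpha D * Real.log (q : ℕ) / (q : ℕ))) →
      ‖(∏' q : Nat.Primes, F1 q) - frakU2Main χ‖ ≤ K * (alpha D * ell D) := by
  set Z2 : ℝ := ∑' n : ℕ, (n : ℝ) ^ (-(2 : ℝ)) with hZ2def
  set Z15 : ℝ := ∑' n : ℕ, (n : ℝ) ^ (-(3 / 2 : ℝ)) with hZ15def
  have hZ2_0 : 0 ≤ Z2 := tsum_nonneg fun n => Real.rpow_nonneg (Nat.cast_nonneg n) _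
  have hZ15_0 : 0 ≤ Z15 := tsum_nonneg fun n => Real.rpow_nonneg (Nat.cast_nonneg n) _
  set E : ℝ := Real.exp (2 * Cb * Z2 + 10 * Z2) with hEdef
  set K : ℝ := E * (2 * Cv + (2 * Cb + 10) * Z15) with hKdef
  have hK0 : 0 ≤ K := by positivity
  refine ⟨K, hK0, fun D _ χ hχ hℓ2 hℓfac F1 hdvd1 hcop1 hval1 => ?_⟩
  have hDpos : 0 < D := Nat.pos_of_ne_zero (NeZero.ne D)
  have hD0 : (0 : ℝ) < D := by exact_mod_cast hDpos
  have hℓ0 : 0 < ell D := by linarith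
  have hα0 : 0 < alpha D := by
    rw [alpha, bigP, Real.log_exp]; positivity
  have hαℓ0 : 0 ≤ alpha D * ell D := by positivity
  -- the prime factors of `D` as a finset of primes
  set S₂ : Finset Nat.Primes := D.primeFactors.subtype Nat.Prime with hS₂def
  have hmemS₂ : ∀ q : Nat.Primes, q ∈ S₂ ↔ (q : ℕ) ∣ D := fun q => by
    have h0 : q ∈ S₂ ↔ (q : ℕ) ∈ D.primeFactors := Finset.mem_subtype
    rw [h0, Nat.mem_primeFactors]
    exact ⟨fun h => h.2.1, fun h => ⟨q.prop, h, hDpos.ne'⟩⟩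
  -- the main factors and the splitting
  set m : Nat.Primes → ℂ := fun q => if (q : ℕ) ∣ D then (1 - ((q : ℕ) : ℂ)⁻¹) ^ 2
      else if (q : ℕ) = 2 ∧ χ (2 : ZMod D) = 1 then (3 / 8 : ℂ)
      else (1 - (((q : ℕ) : ℂ) ^ 2)⁻¹) / frakpFactor χ q with hmdef
  have hmprod : HasProd m (frakU2Main χ) := hasProd_frakU2Main χ hχ
  set mq : Nat.Primes → ℂ := fun q => if (q : ℕ) = 2 ∧ χ (2 : ZMod D) = 1 then (3 / 8 : ℂ)
      else (1 - (((q : ℕ) : ℂ) ^ 2)⁻¹) / frakpFactor χ q with hmqdef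
  set Ψ₁ : Nat.Primes → ℂ := fun q => if (q : ℕ) ∣ D then (1 - (((q : ℕ) : ℂ))⁻¹) ^ 2 else 1
    with hΨ₁def
  set Φ : Nat.Primes → ℂ := fun q => if (q : ℕ) ∣ D then 1 else F1 q with hΦdef
  set Ψ : Nat.Primes → ℂ := fun q => if (q : ℕ) ∣ D then 1 else mq q with hΨdef
  have hsplitF : ∀ q : Nat.Primes, F1 q = Ψ₁ q * Φ q := by
    intro q
    by_cases hqD : (q : ℕ) ∣ D
    · simp only [hΨ₁def, hΦdef, if_pos hqD, mul_one]
      exact hdvd1 q hqD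
    · simp only [hΨ₁def, hΦdef, if_neg hqD, one_mul]
  have hsplitm : ∀ q : Nat.Primes, m q = Ψ₁ q * Ψ q := by
    intro q
    by_cases hqD : (q : ℕ) ∣ D
    · simp only [hmdef, hΨ₁def, hΨdef, if_pos hqD, mul_one]
    · simp only [hmdef, hΨ₁def, hΨdef, hmqdef, if_neg hqD, one_mul]
  -- bounds for `Φ − 1`, `Ψ − 1`, `Φ − Ψ`
  set f : Nat.Primes → ℂ := fun q => Φ q - 1 with hfdef
  set g : Nat.Primes → ℂ := fun q => Ψ q - 1 with hgdef
  have hfb : ∀ q : Nat.Primes, ‖f q‖ ≤ 2 * Cb * ((q : ℕ) : ℝ) ^ (-(2 : ℝ)) := by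
    intro q
    by_cases hqD : (q : ℕ) ∣ D
    · simp only [hfdef, hΦdef, if_pos hqD, sub_self, norm_zero]; positivity
    · simp only [hfdef, hΦdef, if_neg hqD]
      exact hcop1 q hqD
  have hgb : ∀ q : Nat.Primes, ‖g q‖ ≤ 10 * ((q : ℕ) : ℝ) ^ (-(2 : ℝ)) := by
    intro q
    have hqp : (q : ℕ).Prime := q.prop
    have hq0 : (0 : ℝ) < ((q : ℕ) : ℝ) := by exact_mod_cast hqp.pos
    by_cases hqD : (q : ℕ) ∣ D
    · simp only [hgdef, hΨdef, if_pos hqD, sub_self, norm_zero]; positivity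
    · simp only [hgdef, hΨdef, if_neg hqD, hmqdef]
      have h := norm_mainFactor_sub_one_le χ hχ hqp
      have e : (10 : ℝ) / ((q : ℕ) : ℝ) ^ 2 = 10 * ((q : ℕ) : ℝ) ^ (-(2 : ℝ)) := by
        rw [Real.rpow_neg hq0.le, ← Real.rpow_natCast _ 2]; norm_num; ring
      rw [← e]
      convert h using 3
  -- the difference majorant
  set hd : Nat.Primes → ℝ := fun q =>
    (if ((q : ℕ) : ℝ) ≤ D then Cv * (alpha D * Real.log (q : ℕ) / (q : ℕ)) else 0) +
      (2 * Cb + 10) * (D : ℝ) ^ (-(1 / 2 : ℝ)) * ((q : ℕ) : ℝ) ^ (-(3 / 2 : ℝ)) with hhddef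
  have hfgb : ∀ q : Nat.Primes, ‖f q - g q‖ ≤ hd q := by
    intro q
    have hqp : (q : ℕ).Prime := q.prop
    have hq0 : (0 : ℝ) < ((q : ℕ) : ℝ) := by exact_mod_cast hqp.pos
    have hnn1 : 0 ≤ (if ((q : ℕ) : ℝ) ≤ D then Cv * (alpha D * Real.log (q : ℕ) / (q : ℕ)) else 0) := by
      split_ifs
      · exact mul_nonneg hCv (div_nonneg (mul_nonneg hα0.le (Real.log_natCast_nonneg _)) hq0.le)
      · exact le_rfl
    have hnn2 : 0 ≤ (2 * Cb + 10) * (D : ℝ) ^ (-(1 / 2 : ℝ)) * ((q : ℕ) : ℝ) ^ (-(3 / 2 : ℝ)) := by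
      positivity
    by_cases hqD : (q : ℕ) ∣ D
    · have : f q - g q = 0 := by simp only [hfdef, hgdef, hΦdef, hΨdef, if_pos hqD, sub_self]
      rw [this, norm_zero, hhddef]; exact add_nonneg hnn1 hnn2
    · have hfg : f q - g q = F1 q - mq q := by
        simp only [hfdef, hgdef, hΦdef, hΨdef, if_neg hqD]; ring
      rw [hfg]
      by_cases hqle : ((q : ℕ) : ℝ) ≤ D
      · -- `q ≤ D`: the local value
        have h := hval1 q hqD hqle
        simp only [hhddef, if_pos hqle, hmqdef]
        calc ‖F1 q - (if (q : ℕ) = 2 ∧ χ (2 : ZMod D) = 1 then (3 / 8 : ℂ)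
                else (1 - (((q : ℕ) : ℂ) ^ 2)⁻¹) / frakpFactor χ q)‖
            ≤ Cv * (alpha D * Real.log (q : ℕ) / (q : ℕ)) := h
          _ ≤ Cv * (alpha D * Real.log (q : ℕ) / (q : ℕ)) +
                (2 * Cb + 10) * (D : ℝ) ^ (-(1 / 2 : ℝ)) * ((q : ℕ) : ℝ) ^ (-(3 / 2 : ℝ)) := by
              linarith
      · -- `q > D`: both factors are within `O(q⁻²)` of `1`
        have hqD' : (D : ℝ) ≤ ((q : ℕ) : ℝ) := le_of_lt (not_le.mp hqle)
        simp only [hhddef, if_neg hqle, zero_add]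
        have h1 : ‖F1 q - mq q‖ ≤ ‖f q‖ + ‖g q‖ := by
          rw [← hfg]; exact norm_sub_le _ _
        have h2 : ‖f q‖ + ‖g q‖ ≤ (2 * Cb + 10) * ((q : ℕ) : ℝ) ^ (-(2 : ℝ)) := by
          have := hfb q; have := hgb q; linarith
        have h3 : ((q : ℕ) : ℝ) ^ (-(2 : ℝ)) ≤
            (D : ℝ) ^ (-(1 / 2 : ℝ)) * ((q : ℕ) : ℝ) ^ (-(3 / 2 : ℝ)) := by
          have hsplitq : ((q : ℕ) : ℝ) ^ (-(2 : ℝ)) =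
              ((q : ℕ) : ℝ) ^ (-(1 / 2 : ℝ)) * ((q : ℕ) : ℝ) ^ (-(3 / 2 : ℝ)) := by
            rw [← Real.rpow_add hq0]; norm_num
          rw [hsplitq]
          exact mul_le_mul_of_nonneg_right (Real.rpow_le_rpow_of_nonpos hD0 hqD' (by norm_num))
            (Real.rpow_nonneg hq0.le _)
        calc ‖F1 q - mq q‖ ≤ (2 * Cb + 10) * ((q : ℕ) : ℝ) ^ (-(2 : ℝ)) := h1.trans h2
          _ ≤ (2 * Cb + 10) * ((D : ℝ) ^ (-(1 / 2 : ℝ)) * ((q : ℕ) : ℝ) ^ (-(3 / 2 : ℝ))) :=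
              mul_le_mul_of_nonneg_left h3 (by positivity)
          _ = (2 * Cb + 10) * (D : ℝ) ^ (-(1 / 2 : ℝ)) * ((q : ℕ) : ℝ) ^ (-(3 / 2 : ℝ)) := by ring
  -- summability and sizes of the majorants
  have hZ2primes : Summable fun q : Nat.Primes => ((q : ℕ) : ℝ) ^ (-(2 : ℝ)) :=
    summable_primes_rpow (by norm_num)
  have hZ2primes_le : ∑' q : Nat.Primes, ((q : ℕ) : ℝ) ^ (-(2 : ℝ)) ≤ Z2 :=
    tsum_primes_rpow_le (by norm_num)
  have hZ15primes : Summable fun q : Nat.Primes => ((q : ℕ) : ℝ) ^ (-(3 / 2 : ℝ)) :=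
    summable_primes_rpow (by norm_num)
  have hZ15primes_le : ∑' q : Nat.Primes, ((q : ℕ) : ℝ) ^ (-(3 / 2 : ℝ)) ≤ Z15 :=
    tsum_primes_rpow_le (by norm_num)
  have hfsum : Summable fun q => ‖f q‖ :=
    Summable.of_nonneg_of_le (fun _ => norm_nonneg _) hfb (hZ2primes.mul_left _)
  have hgsum : Summable fun q => ‖g q‖ :=
    Summable.of_nonneg_of_le (fun _ => norm_nonneg _) hgb (hZ2primes.mul_left _)
  have hftsum : ∑' q, ‖f q‖ ≤ 2 * Cb * Z2 := by
    calc ∑' q, ‖f q‖ ≤ ∑' q : Nat.Primes, 2 * Cb * ((q : ℕ) : ℝ) ^ (-(2 : ℝ)) :=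
          hfsum.tsum_le_tsum hfb (hZ2primes.mul_left _)
      _ = 2 * Cb * ∑' q : Nat.Primes, ((q : ℕ) : ℝ) ^ (-(2 : ℝ)) := tsum_mul_left
      _ ≤ 2 * Cb * Z2 := mul_le_mul_of_nonneg_left hZ2primes_le (by positivity)
  have hgtsum : ∑' q, ‖g q‖ ≤ 10 * Z2 := by
    calc ∑' q, ‖g q‖ ≤ ∑' q : Nat.Primes, 10 * ((q : ℕ) : ℝ) ^ (-(2 : ℝ)) :=
          hgsum.tsum_le_tsum hgb (hZ2primes.mul_left _)
      _ = 10 * ∑' q : Nat.Primes, ((q : ℕ) : ℝ) ^ (-(2 : ℝ)) := tsum_mul_left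
      _ ≤ 10 * Z2 := mul_le_mul_of_nonneg_left hZ2primes_le (by norm_num)
  -- the local-value part of `hd` is finitely supported (primes `≤ D`)
  set S₃ : Finset Nat.Primes := (Nat.primesLE D).subtype Nat.Prime with hS₃def
  have hmemS₃ : ∀ q : Nat.Primes, q ∈ S₃ ↔ ((q : ℕ) : ℝ) ≤ D := fun q => by
    have h0 : q ∈ S₃ ↔ (q : ℕ) ∈ Nat.primesLE D := Finset.mem_subtype
    rw [h0, Nat.mem_primesLE]
    constructor
    · intro h; exact_mod_cast h.1
    · intro h; exact ⟨by exact_mod_cast h, q.prop⟩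
  set hd1 : Nat.Primes → ℝ := fun q =>
    if ((q : ℕ) : ℝ) ≤ D then Cv * (alpha D * Real.log (q : ℕ) / (q : ℕ)) else 0 with hhd1def
  have hhd1zero : ∀ q ∉ S₃, hd1 q = 0 := fun q hq => by
    simp only [hhd1def, if_neg (fun h => hq ((hmemS₃ q).mpr h))]
  have hhd1sum : Summable hd1 := summable_of_ne_finset_zero hhd1zero
  have hhd1tsum : ∑' q, hd1 q ≤ Cv * (2 * (alpha D * ell D)) := by
    rw [tsum_eq_sum hhd1zero]
    have h1 : ∑ q ∈ S₃, hd1 q = ∑ n ∈ Nat.primesLE D, (if (n : ℝ) ≤ D then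
        Cv * (alpha D * Real.log n / n) else 0) := by
      have h2 : ∑ q ∈ S₃, hd1 q = ∑ n ∈ (Nat.primesLE D).filter Nat.Prime,
          (if (n : ℝ) ≤ D then Cv * (alpha D * Real.log n / n) else 0) :=
        Finset.sum_subtype_eq_sum_filter (fun n : ℕ => if (n : ℝ) ≤ D then
          Cv * (alpha D * Real.log n / n) else 0)
      rw [h2, Finset.filter_true_of_mem fun n hn => (Nat.mem_primesLE.mp hn).2]
    rw [h1]
    have h3 : ∑ n ∈ Nat.primesLE D, (if (n : ℝ) ≤ D then Cv * (alpha D * Real.log n / n) else 0) =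
        ∑ n ∈ Nat.primesLE D, Cv * (alpha D * Real.log n / n) := by
      refine Finset.sum_congr rfl fun n hn => ?_
      rw [if_pos (by exact_mod_cast (Nat.mem_primesLE.mp hn).1)]
    rw [h3, ← Finset.mul_sum]
    refine mul_le_mul_of_nonneg_left ?_ hCv
    have h4 : ∑ n ∈ Nat.primesLE D, alpha D * Real.log n / n =
        alpha D * ∑ n ∈ Nat.primesLE D, Real.log n / n := by
      rw [Finset.mul_sum]
      exact Finset.sum_congr rfl fun n _ => by ring
    rw [h4]
    calc alpha D * ∑ n ∈ Nat.primesLE D, Real.log n / n ≤ alpha D * (2 * ell D) :=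
          mul_le_mul_of_nonneg_left (sum_log_div_primesLE_le hℓ2) hα0.le
      _ = 2 * (alpha D * ell D) := by ring
  have hhd2sum : Summable fun q : Nat.Primes =>
      (2 * Cb + 10) * (D : ℝ) ^ (-(1 / 2 : ℝ)) * ((q : ℕ) : ℝ) ^ (-(3 / 2 : ℝ)) :=
    hZ15primes.mul_left _
  have hhdsum : Summable hd := hhd1sum.add hhd2sum
  have hDhalf : (D : ℝ) ^ (-(1 / 2 : ℝ)) ≤ alpha D * ell D := rpow_neg_half_le_alpha_ell hDpos hℓfac
  have hhdtsum : ∑' q, hd q ≤ (2 * Cv + (2 * Cb + 10) * Z15) * (alpha D * ell D) := by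
    rw [show hd = fun q => hd1 q + (2 * Cb + 10) * (D : ℝ) ^ (-(1 / 2 : ℝ)) *
        ((q : ℕ) : ℝ) ^ (-(3 / 2 : ℝ)) from rfl, hhd1sum.tsum_add hhd2sum, tsum_mul_left]
    have h2 : (2 * Cb + 10) * (D : ℝ) ^ (-(1 / 2 : ℝ)) * ∑' q : Nat.Primes, ((q : ℕ) : ℝ) ^ (-(3 / 2 : ℝ))
        ≤ (2 * Cb + 10) * (alpha D * ell D) * Z15 := by
      calc (2 * Cb + 10) * (D : ℝ) ^ (-(1 / 2 : ℝ)) * ∑' q : Nat.Primes, ((q : ℕ) : ℝ) ^ (-(3 / 2 : ℝ))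
          ≤ (2 * Cb + 10) * (D : ℝ) ^ (-(1 / 2 : ℝ)) * Z15 :=
            mul_le_mul_of_nonneg_left hZ15primes_le (by positivity)
        _ ≤ (2 * Cb + 10) * (alpha D * ell D) * Z15 := by gcongr
    nlinarith [hhd1tsum, h2]
  have hfgsum : Summable fun q => ‖f q - g q‖ :=
    Summable.of_nonneg_of_le (fun _ => norm_nonneg _) hfgb hhdsum
  have hfgtsum : ∑' q, ‖f q - g q‖ ≤ (2 * Cv + (2 * Cb + 10) * Z15) * (alpha D * ell D) :=
    (hfgsum.tsum_le_tsum hfgb hhdsum).trans hhdtsum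
  -- the products: perturbation bound
  have e1 : (fun q => 1 + f q) = Φ := funext fun q => by simp only [hfdef, add_sub_cancel]
  have e2 : (fun q => 1 + g q) = Ψ := funext fun q => by simp only [hgdef, add_sub_cancel]
  have hpert : ‖(∏' q, Φ q) - ∏' q, Ψ q‖ ≤
      Real.exp ((∑' q, ‖f q‖) + ∑' q, ‖g q‖) * ∑' q, ‖f q - g q‖ := by
    have h := AppendixA.norm_tprod_one_add_sub_tprod_one_add_le hfsum hgsum
    rw [e1, e2] at h
    exact h
  have hE : Real.exp ((∑' q, ‖f q‖) + ∑' q, ‖g q‖) ≤ E := by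
    rw [hEdef]; exact Real.exp_le_exp.mpr (add_le_add hftsum hgtsum)
  -- the products: splitting off the primes dividing `D`
  have hΦmul : Multipliable Φ := by
    have h := multipliable_one_add_of_summable hfsum
    rw [e1] at h; exact h
  have hΨmul : Multipliable Ψ := by
    have h := multipliable_one_add_of_summable hgsum
    rw [e2] at h; exact h
  have hΨ₁one : ∀ q ∉ S₂, Ψ₁ q = 1 := fun q hq => by
    simp only [hΨ₁def, if_neg (fun h' => hq ((hmemS₂ q).mpr h'))]
  have hΨ₁mul : Multipliable Ψ₁ := multipliable_of_ne_finset_one hΨ₁one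
  have hprodF : (∏' q : Nat.Primes, F1 q) = (∏' q, Ψ₁ q) * ∏' q, Φ q := by
    rw [show (fun q : Nat.Primes => F1 q) = fun q => Ψ₁ q * Φ q from funext hsplitF]
    exact hΨ₁mul.tprod_mul hΦmul
  have hprodm : frakU2Main χ = (∏' q, Ψ₁ q) * ∏' q, Ψ q := by
    rw [← hmprod.tprod_eq, show m = fun q => Ψ₁ q * Ψ q from funext hsplitm]
    exact hΨ₁mul.tprod_mul hΨmul
  have hΨ₁val : (∏' q, Ψ₁ q) = (Nat.totient D : ℂ) ^ 2 / (D : ℂ) ^ 2 := by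
    rw [tprod_eq_prod hΨ₁one, totient_sq_div_sq_eq_prod hDpos]
    have h1 : ∏ q ∈ S₂, Ψ₁ q = ∏ q ∈ S₂, (1 - (((q : ℕ) : ℂ))⁻¹) ^ 2 :=
      Finset.prod_congr rfl fun q hq => by simp only [hΨ₁def, if_pos ((hmemS₂ q).mp hq)]
    have h2 : ∏ q ∈ S₂, (1 - (((q : ℕ) : ℂ))⁻¹) ^ 2 =
        ∏ n ∈ D.primeFactors.filter Nat.Prime, (1 - ((n : ℂ))⁻¹) ^ 2 :=
      Finset.prod_subtype_eq_prod_filter (fun n : ℕ => (1 - ((n : ℂ))⁻¹) ^ 2)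
    rw [h1, h2, Finset.filter_true_of_mem fun n hn => Nat.prime_of_mem_primeFactors hn]
  -- assembly
  have hCfin0 : 0 ≤ 2 * Cv + (2 * Cb + 10) * Z15 := by positivity
  calc ‖(∏' q : Nat.Primes, F1 q) - frakU2Main χ‖
      = ‖(∏' q, Ψ₁ q) * ((∏' q, Φ q) - ∏' q, Ψ q)‖ := by
        rw [hprodF, hprodm, mul_sub]
    _ = ‖∏' q, Ψ₁ q‖ * ‖(∏' q, Φ q) - ∏' q, Ψ q‖ := norm_mul _ _
    _ ≤ 1 * (E * ((2 * Cv + (2 * Cb + 10) * Z15) * (alpha D * ell D))) := by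
        refine mul_le_mul ?_ (hpert.trans ?_) (norm_nonneg _) zero_le_one
        · rw [hΨ₁val]; exact norm_totient_sq_div_sq_le hDpos
        · exact mul_le_mul hE hfgtsum (tsum_nonneg fun _ => norm_nonneg _) (by positivity)
    _ = K * (alpha D * ell D) := by rw [hKdef]; ring

/-! ## The glue: `Lemma162Rq` from the local inputs -/

open scoped Classical in
/-- **Lemma 16.2 at the repaired normaliser, explicit bound, near-one clause and value
(`Lemma162Rq c′`) — from the local Euler factors** (§16 Lemma 16.2 p. 94; App. A pp. 105–106).
HYPOTHESES, for a family `Φ χ j q s` ("the Euler factor of `E₂ⱼ` at the prime `q`"): (H) `hloc`: for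
all large `D`, under (A), for `j = 1, 2` and every prime `q`, `s ↦ Φ_q(s)` is holomorphic on
`σ > 17/20` and, for `q ∤ D`, `‖Φ_q(s) − 1‖ ≤ C(q^{−2σ} + q^{−1−σ})` there; (D) `hdvd`: for `q ∣ D`,
`Φ_q(s) = (1 − q^{−s})²` on `σ > 17/20`; (E) `hEuler`: on `σ > 1`, `∏_q Φ_q(s)` converges to
`frakU2SeriesR c′ χ j s`; (V) `hval`: for `q ∤ D`, `q ≤ D`, `‖Φ_q(1) − m_q‖ ≤ C·α·log q/q`, `m_q` the
factor of `Typed.Section16B.hasProd_frakU2Main` (`3/8` at `q = 2` when `χ(2) = 1`, else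
`(1 − q⁻²)/𝔭_q`). CONCLUSION: `Lemma162Rq c′`, with the continuation `U := ∏'_q Φ_q`: (i) holomorphic
on `σ > 9/10` (`differentiableOn_tprod_of_local`); (ii) `= frakU2SeriesR` on `σ > 1` (`HasProd.tprod_eq`);
(iii)/(iv) `‖U(s)‖ ≤ C′e^{2𝓛^{1/10}}` on `Re s ≥ 9/10 ⊇ {Re s ≥ 19/20}`
(`exists_halfPlane_bound_of_local`); (v) `‖U(s)‖ ≤ C′𝓛` on `‖s − 1‖ ≤ 1/𝓛`
(`exists_nearOne_bound_of_local`); (vi) `‖U(1) − frakU2Main‖ ≤ C′α𝓛 = C′π𝓛⁻⁸ ≤ C′π𝓛⁻⁴`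
(`exists_value_bound_of_local`). [cite: Zhang2022LandauSiegel, §16 Lemma 16.2 p.94] -/
theorem lemma162Rq_of_local (c' : ℝ)
    (Φ : ∀ {D : ℕ} [NeZero D], DirichletCharacter ℂ D → ℕ → ℕ → ℂ → ℂ)
    (hloc : ∃ C : ℝ, ForAllLarge fun D _ χ => AssumptionA D χ → ∀ j ∈ ({1, 2} : Finset ℕ),
      ∀ q : ℕ, q.Prime →
        DifferentiableOn ℂ (fun s => Φ χ j q s) {s : ℂ | 17 / 20 < s.re} ∧
          (¬ q ∣ D → ∀ s : ℂ, 17 / 20 < s.re →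
            ‖Φ χ j q s - 1‖ ≤ C * ((q : ℝ) ^ (-(2 * s.re)) + (q : ℝ) ^ (-(1 + s.re)))))
    (hdvd : ForAllLarge fun D _ χ => AssumptionA D χ → ∀ j ∈ ({1, 2} : Finset ℕ),
      ∀ q : ℕ, q.Prime → q ∣ D → ∀ s : ℂ, 17 / 20 < s.re →
        Φ χ j q s = (1 - (q : ℂ) ^ (-s)) ^ 2)
    (hEuler : ForAllLarge fun D _ χ => AssumptionA D χ → ∀ j ∈ ({1, 2} : Finset ℕ),
      ∀ s : ℂ, 1 < s.re → HasProd (fun q : Nat.Primes => Φ χ j q s) (frakU2SeriesR c' χ j s))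
    (hval : ∃ C : ℝ, ForAllLarge fun D _ χ => AssumptionA D χ → ∀ j ∈ ({1, 2} : Finset ℕ),
      ∀ q : ℕ, q.Prime → ¬ q ∣ D → (q : ℝ) ≤ D →
        ‖Φ χ j q 1 - (if q = 2 ∧ χ (2 : ZMod D) = 1 then (3 / 8 : ℂ)
            else (1 - (((q : ℂ)) ^ 2)⁻¹) / frakpFactor χ q)‖ ≤
          C * (alpha D * Real.log q / q)) :
    Lemma162Rq c' := by
  obtain ⟨Cb, hloc⟩ := hloc
  obtain ⟨Cv, hval⟩ := hval
  -- constants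
  set Cb' : ℝ := max Cb 0 with hCb'def
  set Cv' : ℝ := max Cv 0 with hCv'def
  have hCb'0 : 0 ≤ Cb' := le_max_right _ _
  have hCv'0 : 0 ≤ Cv' := le_max_right _ _
  obtain ⟨KA, hKA1, hKA⟩ := exists_halfPlane_bound_of_local hCb'0
  obtain ⟨KB, hKB1, hKB⟩ := exists_nearOne_bound_of_local hCb'0
  obtain ⟨KC, hKC0, hKC⟩ := exists_value_bound_of_local hCb'0 hCv'0
  set Cfin : ℝ := KA + KB + KC * π with hCfindef
  have hKA0 : 0 ≤ KA := le_trans zero_le_one hKA1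
  have hKB0 : 0 ≤ KB := le_trans zero_le_one hKB1
  have hKCπ : 0 ≤ KC * π := mul_nonneg hKC0 Real.pi_pos.le
  have hKA_le : KA ≤ Cfin := by rw [hCfindef]; linarith
  have hKB_le : KB ≤ Cfin := by rw [hCfindef]; linarith
  have hKC_le : KC * π ≤ Cfin := by rw [hCfindef]; linarith
  -- thresholds
  obtain ⟨D₁, hD₁⟩ := Ded1524.self_div_totient_le_two_mul_loglog
  obtain ⟨N, hN⟩ := eventually_loglog_pow_six_le
  set L₀ : ℝ := max 2 ((Nat.factorial 9 : ℝ) / (1 / 2 : ℝ) ^ 9) with hL₀def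
  have hT : ForAllLarge fun D _ _ =>
      ((D : ℝ) / Nat.totient D ≤ 2 * Real.log (ell D)) ∧
        ((2 * Real.log (ell D)) ^ 6 ≤ ell D ∧ 10 ≤ ell D) ∧ ⌈Real.exp L₀⌉₊ ≤ D :=
    ForAllLarge.of_le (max (max D₁ N) ⌈Real.exp L₀⌉₊) fun D _ _ hD _ _ =>
      ⟨hD₁ D (le_trans (le_trans (le_max_left _ _) (le_max_left _ _)) hD),
        hN D (le_trans (le_trans (le_max_right _ _) (le_max_left _ _)) hD),
        le_trans (le_max_right _ _) hD⟩
  refine ⟨Cfin, ((((hloc.and hdvd).and hEuler).and hval).and hT).mono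
    fun D _ χ hq _ hS hA j hj => ?_⟩
  obtain ⟨⟨⟨⟨hlocD, hdvdD⟩, hEulerD⟩, hvalD⟩, ⟨hφ, ⟨hpow6, hℓ10⟩, hDL⟩⟩ := hS
  have hDpos : 0 < D := Nat.pos_of_ne_zero (NeZero.ne D)
  have hℓL₀ : L₀ ≤ ell D := ell_ge_of_ge_ceil_exp hDL
  have hℓ2 : 2 ≤ ell D := le_trans (le_max_left _ _) hℓL₀
  have hℓfac : (Nat.factorial 9 : ℝ) / (1 / 2 : ℝ) ^ 9 ≤ ell D := le_trans (le_max_right _ _) hℓL₀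
  have hℓ1 : 1 ≤ ell D := by linarith
  have hℓ0 : 0 < ell D := by linarith
  have hD3 : 3 ≤ D := by
    by_contra hlt
    have hD0 : 0 < (D : ℝ) := by exact_mod_cast hDpos
    have : (D : ℝ) < 3 := by exact_mod_cast not_le.mp hlt
    have : ell D < 3 := by
      calc ell D = Real.log D := rfl
        _ < Real.log (Real.exp 3) := Real.log_lt_log hD0 (by
            have := Real.add_one_le_exp (3:ℝ); linarith)
        _ = 3 := Real.log_exp 3
    linarith
  have hα0 : 0 < alpha D := by
    rw [alpha, bigP, Real.log_exp]; positivity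
  -- the factors at this `D, χ, j`
  set F : Nat.Primes → ℂ → ℂ := fun q s => Φ χ j (q : ℕ) s with hFdef
  have hFdiff : ∀ q : Nat.Primes, DifferentiableOn ℂ (F q) {s : ℂ | 17 / 20 < s.re} :=
    fun q => (hlocD hA j hj q q.prop).1
  have hFdvd : ∀ q : Nat.Primes, (q : ℕ) ∣ D → ∀ s : ℂ, 17 / 20 < s.re →
      F q s = (1 - ((q : ℕ) : ℂ) ^ (-s)) ^ 2 :=
    fun q hqD s hs => hdvdD hA j hj q q.prop hqD s hs
  have hFcop : ∀ q : Nat.Primes, ¬ (q : ℕ) ∣ D → ∀ s : ℂ, 17 / 20 < s.re →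
      ‖F q s - 1‖ ≤ 2 * Cb' * ((q : ℕ) : ℝ) ^ (-(17 / 10 : ℝ)) := by
    intro q hqD s hs
    have hqp : (q : ℕ).Prime := q.prop
    have hq1 : (1 : ℝ) ≤ ((q : ℕ) : ℝ) := by exact_mod_cast hqp.one_lt.le
    have h := (hlocD hA j hj q hqp).2 hqD s hs
    have e1 : ((q : ℕ) : ℝ) ^ (-(2 * s.re)) ≤ ((q : ℕ) : ℝ) ^ (-(17 / 10 : ℝ)) :=
      Real.rpow_le_rpow_of_exponent_le hq1 (by linarith)
    have e2 : ((q : ℕ) : ℝ) ^ (-(1 + s.re)) ≤ ((q : ℕ) : ℝ) ^ (-(17 / 10 : ℝ)) :=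
      Real.rpow_le_rpow_of_exponent_le hq1 (by linarith)
    have hsum0 : 0 ≤ ((q : ℕ) : ℝ) ^ (-(2 * s.re)) + ((q : ℕ) : ℝ) ^ (-(1 + s.re)) := by positivity
    calc ‖F q s - 1‖
        ≤ Cb * (((q : ℕ) : ℝ) ^ (-(2 * s.re)) + ((q : ℕ) : ℝ) ^ (-(1 + s.re))) := h
      _ ≤ Cb' * (((q : ℕ) : ℝ) ^ (-(2 * s.re)) + ((q : ℕ) : ℝ) ^ (-(1 + s.re))) :=
          mul_le_mul_of_nonneg_right (le_max_left _ _) hsum0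
      _ ≤ Cb' * (((q : ℕ) : ℝ) ^ (-(17 / 10 : ℝ)) + ((q : ℕ) : ℝ) ^ (-(17 / 10 : ℝ))) := by
          gcongr
      _ = 2 * Cb' * ((q : ℕ) : ℝ) ^ (-(17 / 10 : ℝ)) := by ring
  -- the continuation
  set U : ℂ → ℂ := fun s => ∏' q : Nat.Primes, F q s with hUdef
  have hUdiff : DifferentiableOn ℂ U {s : ℂ | 17 / 20 < s.re} :=
    differentiableOn_tprod_of_local hDpos hCb'0 F hFdiff hFdvd hFcop
  have hbound : ∀ s : ℂ, 9 / 10 ≤ s.re → ‖U s‖ ≤ KA * Real.exp (2 * ell D ^ (1 / 10 : ℝ)) :=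
    fun s hs => hKA D hDpos F hFdvd hFcop s hs
  have hexp0 : 0 ≤ Real.exp (2 * ell D ^ (1 / 10 : ℝ)) := (Real.exp_pos _).le
  refine ⟨U, ?_, ?_, ?_, ?_, ?_, ?_⟩
  · -- (i) holomorphic on `σ > 9/10`
    exact hUdiff.mono fun s hs => by
      have : 9 / 10 < s.re := hs
      show 17 / 20 < s.re; linarith
  · -- (ii) agreement with `frakU2SeriesR` on `σ > 1`
    intro s hs
    exact (hEulerD hA j hj s hs).tprod_eq
  · -- (iii) bounded on `σ > 9/10`
    exact ⟨KA * Real.exp (2 * ell D ^ (1 / 10 : ℝ)), fun s hs => hbound s hs.le⟩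
  · -- (iv) the explicit bound on `Re s ≥ 19/20`
    intro s hs
    calc ‖U s‖ ≤ KA * Real.exp (2 * ell D ^ (1 / 10 : ℝ)) := hbound s (by linarith)
      _ ≤ Cfin * Real.exp (2 * ell D ^ (1 / 10 : ℝ)) := mul_le_mul_of_nonneg_right hKA_le hexp0
  · -- (v) the near-one bound
    intro s hs
    calc ‖U s‖ ≤ KB * ell D := hKB D hD3 hφ hpow6 hℓ10 F hFdvd hFcop s hs
      _ ≤ Cfin * ell D := mul_le_mul_of_nonneg_right hKB_le hℓ0.le
  · -- (vi) the value at `1`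
    have h1 : (17 : ℝ) / 20 < (1 : ℂ).re := by norm_num
    have hFdvd1 : ∀ q : Nat.Primes, (q : ℕ) ∣ D → F q 1 = (1 - (((q : ℕ) : ℂ))⁻¹) ^ 2 := by
      intro q hqD
      rw [hFdvd q hqD 1 h1, Complex.cpow_neg_one]
    have hFcop1 : ∀ q : Nat.Primes, ¬ (q : ℕ) ∣ D →
        ‖F q 1 - 1‖ ≤ 2 * Cb' * ((q : ℕ) : ℝ) ^ (-(2 : ℝ)) := by
      intro q hqD
      have hqp : (q : ℕ).Prime := q.prop
      have h := (hlocD hA j hj q hqp).2 hqD 1 h1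
      have e : ((q : ℕ) : ℝ) ^ (-(2 * (1 : ℂ).re)) + ((q : ℕ) : ℝ) ^ (-(1 + (1 : ℂ).re)) =
          2 * ((q : ℕ) : ℝ) ^ (-(2 : ℝ)) := by
        simp only [Complex.one_re]; norm_num; ring
      rw [e] at h
      have hsum0 : 0 ≤ 2 * ((q : ℕ) : ℝ) ^ (-(2 : ℝ)) := by positivity
      calc ‖F q 1 - 1‖ ≤ Cb * (2 * ((q : ℕ) : ℝ) ^ (-(2 : ℝ))) := h
        _ ≤ Cb' * (2 * ((q : ℕ) : ℝ) ^ (-(2 : ℝ))) := mul_le_mul_of_nonneg_right (le_max_left _ _) hsum0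
        _ = 2 * Cb' * ((q : ℕ) : ℝ) ^ (-(2 : ℝ)) := by ring
    have hFval1 : ∀ q : Nat.Primes, ¬ (q : ℕ) ∣ D → ((q : ℕ) : ℝ) ≤ D →
        ‖F q 1 - (if (q : ℕ) = 2 ∧ χ (2 : ZMod D) = 1 then (3 / 8 : ℂ)
            else (1 - ((((q : ℕ) : ℂ)) ^ 2)⁻¹) / frakpFactor χ q)‖ ≤
          Cv' * (alpha D * Real.log (q : ℕ) / (q : ℕ)) := by
      intro q hqD hqle
      have hqp : (q : ℕ).Prime := q.prop
      have hq0 : (0 : ℝ) < ((q : ℕ) : ℝ) := by exact_mod_cast hqp.pos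
      have h := hvalD hA j hj q hqp hqD hqle
      exact h.trans (mul_le_mul_of_nonneg_right (le_max_left _ _)
        (div_nonneg (mul_nonneg hα0.le (Real.log_natCast_nonneg _)) hq0.le))
    have hv := hKC D χ hq hℓ2 hℓfac (fun q => F q 1) hFdvd1 hFcop1 hFval1
    calc ‖U 1 - frakU2Main χ‖ ≤ KC * (alpha D * ell D) := hv
      _ ≤ KC * (π * (ell D ^ 4)⁻¹) := mul_le_mul_of_nonneg_left (alpha_mul_ell_le hℓ1) hKC0
      _ = (KC * π) * (ell D ^ 4)⁻¹ := by ring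
      _ ≤ Cfin * (ell D ^ 4)⁻¹ := mul_le_mul_of_nonneg_right hKC_le (by positivity)

open scoped Classical in
/-- **`Lemma162Rp` and `Lemma162R` from the same local inputs** (projections `lemma162Rp_of_Rq`,
`lemma162R_of_Rq`). [cite: Zhang2022LandauSiegel, §16 Lemma 16.2 p.94] -/
theorem lemma162R_of_local (c' : ℝ)
    (Φ : ∀ {D : ℕ} [NeZero D], DirichletCharacter ℂ D → ℕ → ℕ → ℂ → ℂ)
    (hloc : ∃ C : ℝ, ForAllLarge fun D _ χ => AssumptionA D χ → ∀ j ∈ ({1, 2} : Finset ℕ),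
      ∀ q : ℕ, q.Prime →
        DifferentiableOn ℂ (fun s => Φ χ j q s) {s : ℂ | 17 / 20 < s.re} ∧
          (¬ q ∣ D → ∀ s : ℂ, 17 / 20 < s.re →
            ‖Φ χ j q s - 1‖ ≤ C * ((q : ℝ) ^ (-(2 * s.re)) + (q : ℝ) ^ (-(1 + s.re)))))
    (hdvd : ForAllLarge fun D _ χ => AssumptionA D χ → ∀ j ∈ ({1, 2} : Finset ℕ),
      ∀ q : ℕ, q.Prime → q ∣ D → ∀ s : ℂ, 17 / 20 < s.re →
        Φ χ j q s = (1 - (q : ℂ) ^ (-s)) ^ 2)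
    (hEuler : ForAllLarge fun D _ χ => AssumptionA D χ → ∀ j ∈ ({1, 2} : Finset ℕ),
      ∀ s : ℂ, 1 < s.re → HasProd (fun q : Nat.Primes => Φ χ j q s) (frakU2SeriesR c' χ j s))
    (hval : ∃ C : ℝ, ForAllLarge fun D _ χ => AssumptionA D χ → ∀ j ∈ ({1, 2} : Finset ℕ),
      ∀ q : ℕ, q.Prime → ¬ q ∣ D → (q : ℝ) ≤ D →
        ‖Φ χ j q 1 - (if q = 2 ∧ χ (2 : ZMod D) = 1 then (3 / 8 : ℂ)
            else (1 - (((q : ℂ)) ^ 2)⁻¹) / frakpFactor χ q)‖ ≤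
          C * (alpha D * Real.log q / q)) :
    Lemma162Rp c' ∧ Lemma162R c' :=
  ⟨lemma162Rp_of_Rq c' (lemma162Rq_of_local c' Φ hloc hdvd hEuler hval),
    lemma162R_of_Rq c' (lemma162Rq_of_local c' Φ hloc hdvd hEuler hval)⟩

end Literature.NumberTheory.LFunctions.Zhang2022.Typed.Section16B

end
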